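import Mathlib.MeasureTheory.Integral.Prod
import Mathlib.MeasureTheory.Integral.DominatedConvergence
import Mathlib.MeasureTheory.Integral.IntervalIntegral.FundThmCalculus
import Mathlib.MeasureTheory.Function.L2Space
import Mathlib.Analysis.SpecificLimits.Basic
import Literature.Analysis.FluidPDE.ClassicalSolutionCalculus
import Literature.Analysis.FluidPDE.LerayHopf
import Literature.Analysis.FluidPDE.WeakSolutionProofs
import HarnessLib

/-!
# Classical solutions are Leray–Hopf solutions (Leray 1934, §32): the proofs

Analysis/FluidPDE support file 3/3 for — and containing — the discharge
`Literature.Analysis.FluidPDE.IsClassicalNSSolutionOn.isLerayHopfOn_holds` of the named fact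
`Literature.Analysis.FluidPDE.IsClassicalNSSolutionOn.isLerayHopfOn` (`FluidPDE/LerayHopf`): Leray 1934, §32,
p. 242, "Il est tout d'abord évident que toute solution régulière constitue a fortiori une
solution turbulente" — every regular (classical, finite-energy) solution of the Navier–Stokes
equations on `E × [0, T]` is a turbulent (Leray–Hopf weak) solution.

Let `E` be a finite-dimensional real inner product space with Lebesgue measure and `(u, p)` a
classical solution (`IsClassicalNSSolutionOn`) on `[0, T]`. Contents:

* `IsClassicalNSSolutionOn.integral_cutoff_inner_timeDerivWithin` — the localised energy balance
  on a time slice: for a `C¹_c` cut-off `φ`,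
  `∫ φ⟪∂ₜu, u⟫ = ½∫(Dφ·u)|u|² − ν∫φ|∇u|² − ν∫Σᵢ∂ᵢφ⟪∂ᵢu, u⟫ + ∫p(Dφ·u) + ∫φ⟪f, u⟫`
  (pair the momentum equation with `φ u` and integrate by parts with `FluidPDE/WholeSpaceIBP`;
  only first derivatives of `φ` occur);
* `IsClassicalNSSolutionOn.integral_Ioo_integral_mul_inner_timeDerivWithin`,
  `IsClassicalNSSolutionOn.energy_balance_cutoff` — its time integral over `(s, t)` (Fubini and
  the fundamental theorem of calculus on the lines `τ ↦ ½φ(x)|u(τ, x)|²`);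
* `IsClassicalNSSolutionOn.energyEq` — **Leray's energy equality** (§17, (3.4) p. 220,
  "relation de dissipation de l'énergie") `½‖u(t)‖₂² + ν∫ₛᵗ‖∇u‖₂² = ½‖u(s)‖₂² + ∫ₛᵗ∫⟪f, u⟫` for
  `0 ≤ s ≤ t ≤ T`, under `u(τ) ∈ L²` with `sup_τ ∫|u(τ)|² < ∞`, `∇u ∈ L²_{t,x}`, `u ∈ L³_{t,x}`,
  `p u, ⟪f, u⟫ ∈ L¹_{t,x}`: take `φ = Fluid.cutoff (n + 1)` and let `n → ∞` — the three terms
  carrying `Dφ = O(1/n)` are `O(1/n)` by the `L³`, `L²` and `L¹` hypotheses (Young's inequality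
  for the viscous cross term), the dissipation and forcing terms converge by dominated
  convergence on `(s, t) × E`, the kinetic terms by dominated convergence on `E`;
* `ContinuousInLpOn.exists_continuousOn_toLp` — `u ∈ C(S; L^q)` lifts to a map `ℝ → L^q`
  continuous on `S`; `eEnergy_eq_eLpNorm_sq`;
* `IsClassicalNSSolutionOn.isLerayHopfOn_holds` — the assembly: weak formulation
  (`isWeakNSSolutionOn_holds`, file 2/3), energy inequalities from `energyEq` with the classical
  gradient (a weak gradient, `hasWeakGradient_fderiv_of_contDiff`), uniform energy bound and
  weak/strong `L²` continuity from the `L²` lift (`T > 0` gives `𝓝[>] 0 ≤ 𝓝[[0, T]] 0`).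

## Mixed classes and the initial datum (glue for Escauriaza–Seregin–Šverák 2003, §3)

Two further sections provide measure-theoretic glue used by the decomposition of the
Escauriaza–Seregin–Šverák endpoint theorem (`FluidPDE/NSLerayHopfProofs`):

* mixed classes `Fluid.MemLqLp`: gluing of two time sets (`MemLqLp.union`), transfer along
  slice-wise a.e. equality (`MemLqLp.congr_ae_slice`), the a.e. bound by the `L^∞_t` mixed norm
  (`MemLqLp.ae_eLpNorm_le_top`), `L^∞_t` to `L^q_t` on finite time sets
  (`memLqLp_of_ae_eLpNorm_le`), and the interpolations `L^∞_tL^∞_x ∩ L^∞_tL³_x ⊂ L⁵_tL⁵_x`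
  (finite time set; `‖f‖₅⁵ ≤ ‖f‖_∞² ‖f‖₃³`) and `L^∞_tL³_x ∩ L²_tL⁶_x ⊂ L⁴_tL⁴_x`
  (`‖f‖₄⁴ ≤ ‖f‖₃² ‖f‖₆²`, Hölder), the Lebesgue interpolation of Robinson–Rodrigo–Sadowski 2016,
  Thm. 1.5 / Lemma 3.5;
* the datum `u₀` of a Leray–Hopf solution on `[0, T)`, `T > 0` — an arbitrary function entering
  `IsLerayHopfOn` only through integrals: it is weakly divergence free
  (`IsLerayHopfOn.isWeaklyDivFree_datum`, the limit `t → 0⁺` of the a.e. vanishing pairings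
  `∫ ⟪u(t), ∇θ⟫`); if it is a.e. strongly measurable it lies in `L²` (`memLp_two_datum`) and, when
  `u ∈ L^∞(0, T; L³)`, in `L³` (`memLp_three_datum`: Fatou along an a.e. convergent sequence
  `u(tₙ) → u₀`, Escauriaza–Seregin–Šverák 2003, (3.1)); and the dichotomy
  `IsLerayHopfOn.aestronglyMeasurable_datum_or`: either `u₀` is a.e. strongly measurable, or every
  pairing `∫ ⟪u₀, w⟫`, `w ∈ L²`, vanishes (a non-integrable pairing kills the additive datum
  functional under the Bochner convention), in which case `u` is a weak solution with datum `0`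
  (`isWeakNSSolutionOn_zero_datum`).

## Restriction in time (Leray 1934, §III)

The last section discharges the named fact `Literature.Analysis.FluidPDE.IsLerayHopfOn.mono` (`FluidPDE/LerayHopf`)
as `IsLerayHopfOn.mono_holds` (usable form `IsLerayHopfOn.of_le`): a Leray–Hopf weak solution
on `[0, T)` is one on `[0, T')` for every `T' ≤ T`. The weak formulation restricts by
`IsWeakNSSolutionOn.of_le` (`FluidPDE/WeakSolutionProofs`); the energy bound, the a.e. weak
gradient and the a.e.-`s` energy inequality restrict along `Ioo 0 T' ⊆ Ioo 0 T` (`ae_mono`),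
the dissipation bound by monotonicity of the lower integral in the time set, the slice
conditions along `Icc 0 T' ⊆ Icc 0 T`, `Icc s T' ⊆ Icc s T`, weak continuity along
`Ioc 0 T' ⊆ Ioc 0 T`; the two conditions at `t → 0⁺` do not see `T`.

## References

* J. Leray, *Sur le mouvement d'un liquide visqueux emplissant l'espace*, Acta Math. 63 (1934),
  193–248: §17 (3.4) p. 220; §31 pp. 240–241 (solutions turbulentes); §32 p. 242.
* G. P. Galdi, *An introduction to the Navier–Stokes initial-boundary value problem* (2000),
  Def. 2.1, Thm. 4.1.
* J. C. Robinson, J. L. Rodrigo, W. Sadowski, *The three-dimensional Navier–Stokes equations*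
  (CUP 2016), §1.7, Thm. 4.6.
* L. Escauriaza, G. Seregin, V. Šverák, *`L_{3,∞}`-solutions of Navier–Stokes equations and
  backward uniqueness*, Russ. Math. Surveys 58:2 (2003) 211–250, §3, (3.1).
* W. S. Ożański, B. C. Pooley, *Leray's fundamental work on the Navier–Stokes equations: a
  modern review of "Sur le mouvement d'un liquide visqueux emplissant l'espace"*,
  arXiv:1708.09787, Thm. 1.7 (energy equality (3.4)).
-/

noncomputable section

open MeasureTheory TopologicalSpace Set Function Filter Topology InnerProductSpace
open scoped RealInnerProductSpace ENNReal NNReal Laplacian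

namespace Literature.Analysis.FluidPDE

/-! ### The energy equality for classical solutions -/

section Energy

variable {E : Type*} [NormedAddCommGroup E] [InnerProductSpace ℝ E] [FiniteDimensional ℝ E]
  [MeasurableSpace E] [BorelSpace E]

omit [MeasurableSpace E] [BorelSpace E] in
/-- `⟪v, ∇θ(x)⟫ = Dθ(x) v`. [folklore] -/
theorem inner_gradient_right_eq_fderiv {θ : E → ℝ} (x v : E) :
    ⟪v, gradient θ x⟫ = fderiv ℝ θ x v := by
  rw [gradient, real_inner_comm, InnerProductSpace.toDual_symm_apply]

variable {ν : ℝ} {f u : ℝ → E → E} {p : ℝ → E → ℝ}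

/-- **The localised energy balance of a classical solution** (slice identity). For a classical
solution on a time set `S` of unique differentiability, `t ∈ S`, and a smooth compactly
supported scalar cut-off `φ`, pairing the momentum equation with `φ u` and integrating by parts
in `x` (only first derivatives of `φ` appear):
`∫ φ ⟪∂ₜu, u⟫ = ½ ∫ (Dφ·u) |u|² − ν ∫ φ |∇u|² − ν ∫ Σᵢ ∂ᵢφ ⟪∂ᵢu, u⟫ + ∫ p (Dφ·u) + ∫ φ ⟪f, u⟫`
(Leray 1934, §17: the computation giving (3.4), there for fields decaying at infinity so that
`φ ≡ 1` is allowed; Galdi 2000, Thm. 4.1). [cite: Leray1934, §17 (3.4) p. 220] -/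
theorem IsClassicalNSSolutionOn.integral_cutoff_inner_timeDerivWithin {S : Set ℝ}
    (h : IsClassicalNSSolutionOn S ν f u p) (hS : UniqueDiffOn ℝ S) {t : ℝ} (ht : t ∈ S)
    {φ : E → ℝ} (hφ : ContDiff ℝ 1 φ) (hc : HasCompactSupport φ) :
    ∫ x, φ x * ⟪timeDerivWithin S u t x, u t x⟫ =
      2⁻¹ * (∫ x, fderiv ℝ φ x (u t x) * ‖u t x‖ ^ 2)
      - ν * (∫ x, φ x * frobeniusNormSq (fderiv ℝ (u t) x))
      - ν * (∫ x, ∑ i, fderiv ℝ φ x (stdOrthonormalBasis ℝ E i) *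
          ⟪fderiv ℝ (u t) x (stdOrthonormalBasis ℝ E i), u t x⟫)
      + (∫ x, p t x * fderiv ℝ φ x (u t x))
      + ∫ x, φ x * ⟪f t x, u t x⟫ := by
  set b := stdOrthonormalBasis ℝ E
  set w : E → E := fun x => φ x • u t x with hw
  -- regularity
  have hu2 : ContDiff ℝ 2 (u t) := contDiff_infty.1 (h.contDiff_velocity ht) 2
  have hu1 : ContDiff ℝ 1 (u t) := hu2.of_le one_le_two
  have hp1 : ContDiff ℝ 1 (p t) := contDiff_infty.1 (h.contDiff_pressure ht) 1
  have hw1 : ContDiff ℝ 1 w := hφ.smul hu1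
  have hcw : HasCompactSupport w := hc.smul_right
  have huc : Continuous (u t) := hu1.continuous
  have hφc : Continuous φ := hφ.continuous
  have hDφc : Continuous (fderiv ℝ φ) := hφ.continuous_fderiv one_ne_zero
  have hDuc : Continuous (fderiv ℝ (u t)) := hu1.continuous_fderiv one_ne_zero
  have hwc : Continuous w := hw1.continuous
  have hdtc : Continuous (timeDerivWithin S u t) :=
    ((h.smooth_velocity.timeDerivWithin hS).contDiff_slice ht).continuous
  have hfc : Continuous (f t) := h.continuous_force_slice hS ht
  have hcDφ : HasCompactSupport (fderiv ℝ φ) := hc.fderiv (𝕜 := ℝ)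
  -- the force through the equation
  have hf_eq : ∀ x, f t x = timeDerivWithin S u t x + convect (u t) (u t) x - ν • (Δ (u t)) x +
      gradient (p t) x := fun x => by
    have := h.momentum t ht x
    rw [eq_comm, ← sub_eq_zero] at this
    rw [← sub_eq_zero, ← this]
    abel
  -- pointwise Leibniz rules for `w = φ u`
  have hDw : ∀ x v, fderiv ℝ w x v = φ x • fderiv ℝ (u t) x v + (fderiv ℝ φ x v) • u t x :=
    fun x v => by
      simp [hw, fderiv_fun_smul (hφ.differentiable one_ne_zero x) (hu1.differentiable one_ne_zero x)]
  have hCw : ∀ x, convect (u t) w x = φ x • convect (u t) (u t) x + (fderiv ℝ φ x (u t x)) • u t x :=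
    fun x => convect_smul_apply (hφ.differentiable one_ne_zero x) (hu1.differentiable one_ne_zero x)
  -- integrability of every term (continuous with compact support)
  have cs_φ : ∀ {g : E → ℝ}, Continuous g → Integrable (fun x => φ x * g x) (volume : Measure E) :=
    fun hg => (hφc.mul hg).integrable_of_hasCompactSupport hc.mul_right
  have cs_Dφ : ∀ {g : E → ℝ} (v : E → E), Continuous g → Continuous v →
      Integrable (fun x => fderiv ℝ φ x (v x) * g x) (volume : Measure E) := fun v hg hv =>
    ((hDφc.clm_apply hv).mul hg).integrable_of_hasCompactSupport
      ((hcDφ.mono fun x hx => by contrapose! hx; simp_all).mul_right)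
  -- (i) the convection term
  have eC : ∫ x, ⟪convect (u t) (u t) x, w x⟫ =
      -(2⁻¹ * ∫ x, fderiv ℝ φ x (u t x) * ‖u t x‖ ^ 2) := by
    have h0 := integral_inner_convect_add_eq_zero hu1 hu1 hw1 hcw
    have hz : ∫ x, VectorCalculus.divergence (u t) x * ⟪u t x, w x⟫ = 0 := by simp [h.divFree t ht _]
    have hA : ∫ x, ⟪convect (u t) (u t) x, w x⟫ = ∫ x, φ x * ⟪u t x, convect (u t) (u t) x⟫ :=
      integral_congr_ae (Eventually.of_forall fun x => by
        simp only [hw, real_inner_smul_right]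
        rw [real_inner_comm])
    have iA : Integrable (fun x => φ x * ⟪u t x, convect (u t) (u t) x⟫) (volume : Measure E) :=
      cs_φ (huc.inner (hDuc.clm_apply huc))
    have iB : Integrable (fun x => fderiv ℝ φ x (u t x) * ‖u t x‖ ^ 2) (volume : Measure E) :=
      cs_Dφ _ (huc.norm.pow 2) huc
    have hB : ∫ x, ⟪u t x, convect (u t) w x⟫ = (∫ x, φ x * ⟪u t x, convect (u t) (u t) x⟫) +
        ∫ x, fderiv ℝ φ x (u t x) * ‖u t x‖ ^ 2 := by
      rw [← integral_add iA iB]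
      refine integral_congr_ae (Eventually.of_forall fun x => ?_)
      simp only [hCw, inner_add_right, real_inner_smul_right, real_inner_self_eq_norm_sq]
    rw [hA] at h0 ⊢
    linarith
  -- (ii) the viscous term
  have eL : ∫ x, ⟪(Δ (u t)) x, w x⟫ = -(∫ x, φ x * frobeniusNormSq (fderiv ℝ (u t) x)) -
      ∫ x, ∑ i, fderiv ℝ φ x (b i) * ⟪fderiv ℝ (u t) x (b i), u t x⟫ := by
    have h0 := integral_inner_laplacian_add_eq_zero b hu2 hw1 (Or.inr hcw)
    have iA : ∀ i, Integrable (fun x => φ x * ‖fderiv ℝ (u t) x (b i)‖ ^ 2) (volume : Measure E) :=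
      fun i => cs_φ ((hDuc.clm_apply continuous_const).norm.pow 2)
    have iB : ∀ i, Integrable (fun x => fderiv ℝ φ x (b i) * ⟪fderiv ℝ (u t) x (b i), u t x⟫)
        (volume : Measure E) := fun i =>
      cs_Dφ _ ((hDuc.clm_apply continuous_const).inner huc) continuous_const
    have h1 : ∀ i, ∫ x, ⟪fderiv ℝ (u t) x (b i), fderiv ℝ w x (b i)⟫ =
        (∫ x, φ x * ‖fderiv ℝ (u t) x (b i)‖ ^ 2) +
          ∫ x, fderiv ℝ φ x (b i) * ⟪fderiv ℝ (u t) x (b i), u t x⟫ := fun i => by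
      rw [← integral_add (iA i) (iB i)]
      refine integral_congr_ae (Eventually.of_forall fun x => ?_)
      simp only [hDw, inner_add_right, real_inner_smul_right, real_inner_self_eq_norm_sq]
    have h2 : ∑ i, ∫ x, φ x * ‖fderiv ℝ (u t) x (b i)‖ ^ 2 =
        ∫ x, φ x * frobeniusNormSq (fderiv ℝ (u t) x) := by
      rw [← integral_finsetSum _ fun i _ => iA i]
      refine integral_congr_ae (Eventually.of_forall fun x => ?_)
      simp only [frobeniusNormSq_eq_sum b, Finset.mul_sum]
    have h3 : ∑ i, ∫ x, fderiv ℝ φ x (b i) * ⟪fderiv ℝ (u t) x (b i), u t x⟫ =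
        ∫ x, ∑ i, fderiv ℝ φ x (b i) * ⟪fderiv ℝ (u t) x (b i), u t x⟫ :=
      (integral_finsetSum _ fun i _ => iB i).symm
    simp_rw [h1] at h0
    rw [Finset.sum_add_distrib, h2, h3] at h0
    linarith
  -- (iii) the pressure term
  have eP : ∫ x, ⟪gradient (p t) x, w x⟫ = -∫ x, p t x * fderiv ℝ φ x (u t x) := by
    rw [integral_inner_gradient_eq_neg_integral_mul_divergence hp1 hw1 hcw]
    congr 1
    refine integral_congr_ae (Eventually.of_forall fun x => ?_)
    simp only [hw]
    rw [divergence_smul_apply (hφ.differentiable one_ne_zero x) (hu1.differentiable one_ne_zero x),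
      h.divFree t ht x, mul_zero, zero_add, inner_gradient_right_eq_fderiv]
  -- integrability of the paired terms
  have iT : Integrable (fun x => ⟪timeDerivWithin S u t x, w x⟫) (volume : Measure E) :=
    integrable_inner_of_hasCompactSupport_right hdtc hwc hcw
  have iC : Integrable (fun x => ⟪convect (u t) (u t) x, w x⟫) (volume : Measure E) :=
    integrable_inner_of_hasCompactSupport_right (hDuc.clm_apply huc) hwc hcw
  have iL : Integrable (fun x => ⟪(Δ (u t)) x, w x⟫) (volume : Measure E) :=
    integrable_inner_of_hasCompactSupport_right (continuous_laplacian hu2) hwc hcw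
  have iP : Integrable (fun x => ⟪gradient (p t) x, w x⟫) (volume : Measure E) :=
    integrable_inner_of_hasCompactSupport_right (continuous_gradient_of_contDiff hp1) hwc hcw
  have iF : Integrable (fun x => ⟪f t x, w x⟫) (volume : Measure E) :=
    integrable_inner_of_hasCompactSupport_right hfc hwc hcw
  -- assemble
  have hL : ∫ x, φ x * ⟪timeDerivWithin S u t x, u t x⟫ = ∫ x, ⟪timeDerivWithin S u t x, w x⟫ :=
    integral_congr_ae (Eventually.of_forall fun x => by simp only [hw, real_inner_smul_right])
  have hF : ∫ x, φ x * ⟪f t x, u t x⟫ = ∫ x, ⟪f t x, w x⟫ :=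
    integral_congr_ae (Eventually.of_forall fun x => by simp only [hw, real_inner_smul_right])
  have key : ∀ x, ⟪timeDerivWithin S u t x, w x⟫ = ⟪f t x, w x⟫ -
      ⟪convect (u t) (u t) x, w x⟫ + ν * ⟪(Δ (u t)) x, w x⟫ - ⟪gradient (p t) x, w x⟫ := by
    intro x
    rw [hf_eq x]
    simp only [inner_add_left, inner_sub_left, inner_smul_left, RCLike.conj_to_real]
    ring
  have j1 : Integrable (fun x => ⟪f t x, w x⟫ - ⟪convect (u t) (u t) x, w x⟫)
      (volume : Measure E) := iF.sub iC
  have j2 : Integrable (fun x => ν * ⟪(Δ (u t)) x, w x⟫) (volume : Measure E) := iL.const_mul ν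
  have j3 : Integrable (fun x => ⟪f t x, w x⟫ - ⟪convect (u t) (u t) x, w x⟫ +
      ν * ⟪(Δ (u t)) x, w x⟫) (volume : Measure E) := j1.add j2
  rw [hL, hF, integral_congr_ae (Eventually.of_forall key), integral_sub j3 iP, integral_add j1 j2,
    integral_sub iF iC, integral_const_mul, eC, eL, eP]
  ring

/-! ### The energy identity integrated in time, for a fixed cut-off -/

omit [MeasurableSpace E] [BorelSpace E] in
/-- The squared Frobenius norm is a continuous function of the operator (finite sum of squared
norms of evaluations). [folklore] -/
theorem LerayHopfProofs.continuous_frobeniusNormSq {F' : Type*} [NormedAddCommGroup F'] [InnerProductSpace ℝ F']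
    [FiniteDimensional ℝ F'] : Continuous (frobeniusNormSq : (E →L[ℝ] F') → ℝ) := by
  unfold frobeniusNormSq
  exact continuous_finsetSum _ fun i _ =>
    ((ContinuousLinearMap.apply ℝ F' (stdOrthonormalBasis ℝ E i)).continuous.norm).pow 2

variable {T : ℝ}

/-- **Time integration of the localised energy balance, left-hand side.** For a classical
solution on `[0, T]`, a continuous compactly supported weight `φ` and `0 ≤ s ≤ t ≤ T`,
`∫ₛᵗ ∫ φ ⟪∂ₜu, u⟫ dx dτ = ½ ∫ φ |u(t)|² − ½ ∫ φ |u(s)|²` (Fubini on `(s, t) × E`, the integrand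
being continuous with compact `x`-support, and the fundamental theorem of calculus on each time
line `τ ↦ ½ φ(x) |u(τ, x)|²`; Leray 1934, §17, the step from (3.1) to (3.4)). [cite: Leray1934, §17 (3.4) p. 220] -/
theorem IsClassicalNSSolutionOn.integral_Ioo_integral_mul_inner_timeDerivWithin
    (h : IsClassicalNSSolutionOn (Icc 0 T) ν f u p) (hT : 0 < T) {φ : E → ℝ} (hφ : Continuous φ)
    (hc : HasCompactSupport φ) {s t : ℝ} (hs : 0 ≤ s) (hst : s ≤ t) (ht : t ≤ T) :
    ∫ τ in Ioo s t, ∫ x, φ x * ⟪timeDerivWithin (Icc 0 T) u τ x, u τ x⟫ =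
      2⁻¹ * (∫ x, φ x * ‖u t x‖ ^ 2) - 2⁻¹ * (∫ x, φ x * ‖u s x‖ ^ 2) := by
  have hU : UniqueDiffOn ℝ (Icc 0 T) := uniqueDiffOn_Icc hT
  have hu_cont : ContinuousOn (uncurry u) (Icc 0 T ×ˢ univ) := h.smooth_velocity.continuousOn
  have hdt_cont : ContinuousOn (uncurry (timeDerivWithin (Icc 0 T) u)) (Icc 0 T ×ˢ univ) :=
    (h.smooth_velocity.timeDerivWithin hU).continuousOn
  have hsub : Icc s t ×ˢ (univ : Set E) ⊆ Icc 0 T ×ˢ univ :=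
    prod_mono (Icc_subset_Icc hs ht) Subset.rfl
  have hKφ : ∀ x ∉ tsupport φ, φ x = 0 := fun x hx => image_eq_zero_of_notMem_tsupport hx
  -- the integrand and its integrability on `(s, t) × E`
  set D : ℝ × E → ℝ := fun z => φ z.2 * ⟪timeDerivWithin (Icc 0 T) u z.1 z.2, u z.1 z.2⟫ with hD
  have hDcont : ContinuousOn D (Icc s t ×ˢ univ) :=
    (hφ.comp continuous_snd).continuousOn.mul ((hdt_cont.mono hsub).inner (hu_cont.mono hsub))
  have hDK : ∀ τ ∈ Icc s t, ∀ x ∉ tsupport φ, D (τ, x) = 0 := fun τ _ x hx => by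
    simp [hD, hKφ x hx]
  have hDint := integrable_prod_of_continuousOn hc hDcont hDK
  have hswap := integral_integral_swap (f := fun τ x => D (τ, x)) hDint
  simp only [hD] at hswap
  rw [hswap]
  -- integrability of the two slices `φ |u(t)|²`, `φ |u(s)|²`
  have hslice : ∀ {r : ℝ}, r ∈ Icc 0 T →
      Integrable (fun x => φ x * ‖u r x‖ ^ 2) (volume : Measure E) := fun hr =>
    (hφ.mul ((h.contDiff_velocity hr).continuous.norm.pow 2)).integrable_of_hasCompactSupport
      hc.mul_right
  have htI : t ∈ Icc 0 T := ⟨hs.trans hst, ht⟩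
  have hsI : s ∈ Icc 0 T := ⟨hs, hst.trans ht⟩
  -- the fundamental theorem of calculus on each time line
  have hline : ∀ x, ∫ τ in Ioo s t, φ x * ⟪timeDerivWithin (Icc 0 T) u τ x, u τ x⟫ =
      2⁻¹ * (φ x * ‖u t x‖ ^ 2) - 2⁻¹ * (φ x * ‖u s x‖ ^ 2) := by
    intro x
    rcases eq_or_lt_of_le hst with rfl | hst'
    · simp
    have hcont : ContinuousOn (fun τ => 2⁻¹ * (φ x * ‖u τ x‖ ^ 2)) (Icc s t) := by
      refine continuousOn_const.mul (continuousOn_const.mul (ContinuousOn.pow ?_ 2))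
      exact (hu_cont.comp (Continuous.prodMk_left x).continuousOn
        fun τ hτ => mk_mem_prod (Icc_subset_Icc hs ht hτ) (mem_univ x)).norm
    have hderiv : ∀ τ ∈ Ioo s t, HasDerivWithinAt (fun τ => 2⁻¹ * (φ x * ‖u τ x‖ ^ 2))
        (φ x * ⟪timeDerivWithin (Icc 0 T) u τ x, u τ x⟫) (Ioi τ) τ := by
      intro τ hτ
      have hτ0 : τ ∈ Ioo 0 T := ⟨hs.trans_lt hτ.1, hτ.2.trans_le ht⟩
      have hu' : HasDerivAt (fun σ => u σ x) (timeDerivWithin (Icc 0 T) u τ x) τ :=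
        (h.smooth_velocity.hasDerivWithinAt_timeDerivWithin hU (Ioo_subset_Icc_self hτ0)
          x).hasDerivAt (Icc_mem_nhds hτ0.1 hτ0.2)
      have h2 := ((hu'.inner ℝ hu').const_mul (2⁻¹ * φ x)).hasDerivWithinAt (s := Ioi τ)
      have hfun : (fun σ => 2⁻¹ * φ x * ⟪u σ x, u σ x⟫) = fun σ => 2⁻¹ * (φ x * ‖u σ x‖ ^ 2) := by
        funext σ
        rw [real_inner_self_eq_norm_sq]
        ring
      rw [hfun] at h2
      refine h2.congr_deriv ?_
      rw [real_inner_comm]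
      ring
    have hint : IntervalIntegrable (fun τ => φ x * ⟪timeDerivWithin (Icc 0 T) u τ x, u τ x⟫)
        volume s t := by
      refine ContinuousOn.intervalIntegrable ?_
      rw [uIcc_of_le hst]
      exact hDcont.comp (Continuous.prodMk_left x).continuousOn
        fun τ hτ => mk_mem_prod hτ (mem_univ x)
    have := intervalIntegral.integral_eq_sub_of_hasDeriv_right_of_le hst hcont hderiv hint
    rw [intervalIntegral.integral_of_le hst, integral_Ioc_eq_integral_Ioo] at this
    rw [this]
  rw [integral_congr_ae (Eventually.of_forall hline), integral_sub ((hslice htI).const_mul _)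
    ((hslice hsI).const_mul _), integral_const_mul, integral_const_mul]

/-- **Time integration of the localised energy balance.** For a classical solution on `[0, T]`,
a `C¹` compactly supported cut-off `φ` and `0 ≤ s ≤ t ≤ T`:
`½∫φ|u(t)|² − ½∫φ|u(s)|² = ½∫ₛᵗ∫(Dφ·u)|u|² − ν∫ₛᵗ∫φ|∇u|² − ν∫ₛᵗ∫Σᵢ∂ᵢφ⟪∂ᵢu, u⟫ + ∫ₛᵗ∫p(Dφ·u)
+ ∫ₛᵗ∫φ⟪f, u⟫` (the slice identity `integral_cutoff_inner_timeDerivWithin` integrated over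
`(s, t)`; every integrand is continuous on `[s, t] × E` with compact `x`-support, so the time
integral splits term by term; Leray 1934, §17, the localised form of (3.4)). [cite: Leray1934, §17 (3.4) p. 220] -/
theorem IsClassicalNSSolutionOn.energy_balance_cutoff
    (h : IsClassicalNSSolutionOn (Icc 0 T) ν f u p) (hT : 0 < T) {φ : E → ℝ}
    (hφ : ContDiff ℝ 1 φ) (hc : HasCompactSupport φ) {s t : ℝ} (hs : 0 ≤ s) (hst : s ≤ t)
    (ht : t ≤ T) :
    2⁻¹ * (∫ x, φ x * ‖u t x‖ ^ 2) - 2⁻¹ * (∫ x, φ x * ‖u s x‖ ^ 2) =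
      2⁻¹ * (∫ τ in Ioo s t, ∫ x, fderiv ℝ φ x (u τ x) * ‖u τ x‖ ^ 2)
      - ν * (∫ τ in Ioo s t, ∫ x, φ x * frobeniusNormSq (fderiv ℝ (u τ) x))
      - ν * (∫ τ in Ioo s t, ∫ x, ∑ i, fderiv ℝ φ x (stdOrthonormalBasis ℝ E i) *
          ⟪fderiv ℝ (u τ) x (stdOrthonormalBasis ℝ E i), u τ x⟫)
      + (∫ τ in Ioo s t, ∫ x, p τ x * fderiv ℝ φ x (u τ x))
      + ∫ τ in Ioo s t, ∫ x, φ x * ⟪f τ x, u τ x⟫ := by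
  set b := stdOrthonormalBasis ℝ E
  have hU : UniqueDiffOn ℝ (Icc 0 T) := uniqueDiffOn_Icc hT
  rw [← h.integral_Ioo_integral_mul_inner_timeDerivWithin hT hφ.continuous hc hs hst ht]
  -- joint continuity on `[s, t] × E`
  have hsub : Icc s t ×ˢ (univ : Set E) ⊆ Icc 0 T ×ˢ univ :=
    prod_mono (Icc_subset_Icc hs ht) Subset.rfl
  have cu : ContinuousOn (fun z : ℝ × E => u z.1 z.2) (Icc s t ×ˢ univ) :=
    h.smooth_velocity.continuousOn.mono hsub
  have cDu : ContinuousOn (fun z : ℝ × E => fderiv ℝ (u z.1) z.2) (Icc s t ×ˢ univ) :=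
    (h.smooth_velocity.fderiv_slice hU).continuousOn.mono hsub
  have cp : ContinuousOn (fun z : ℝ × E => p z.1 z.2) (Icc s t ×ˢ univ) :=
    h.smooth_pressure.continuousOn.mono hsub
  have cf : ContinuousOn (fun z : ℝ × E => f z.1 z.2) (Icc s t ×ˢ univ) :=
    (h.continuousOn_force hU).mono hsub
  have cφ : ContinuousOn (fun z : ℝ × E => φ z.2) (Icc s t ×ˢ univ) :=
    (hφ.continuous.comp continuous_snd).continuousOn
  have cDφ : ContinuousOn (fun z : ℝ × E => fderiv ℝ φ z.2) (Icc s t ×ˢ univ) :=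
    ((hφ.continuous_fderiv one_ne_zero).comp continuous_snd).continuousOn
  -- everything vanishes for `x` off the support of `φ`
  have hφK : ∀ x ∉ tsupport φ, φ x = 0 := fun x hx => image_eq_zero_of_notMem_tsupport hx
  have hDφK : ∀ x ∉ tsupport φ, fderiv ℝ φ x = 0 := fun x hx => fderiv_of_notMem_tsupport ℝ hx
  -- integrability on `(s, t) × E` of the five integrands, hence of their slice integrals
  have i1 : Integrable (fun z : ℝ × E => fderiv ℝ φ z.2 (u z.1 z.2) * ‖u z.1 z.2‖ ^ 2)
      (((volume : Measure ℝ).restrict (Ioo s t)).prod (volume : Measure E)) :=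
    integrable_prod_of_continuousOn hc ((cDφ.clm_apply cu).mul (cu.norm.pow 2))
      fun τ _ x hx => by simp [hDφK x hx]
  have i2 : Integrable (fun z : ℝ × E => φ z.2 * frobeniusNormSq (fderiv ℝ (u z.1) z.2))
      (((volume : Measure ℝ).restrict (Ioo s t)).prod (volume : Measure E)) :=
    integrable_prod_of_continuousOn hc (cφ.mul (LerayHopfProofs.continuous_frobeniusNormSq.comp_continuousOn cDu))
      fun τ _ x hx => by simp [hφK x hx]
  have i3 : Integrable (fun z : ℝ × E => ∑ i, fderiv ℝ φ z.2 (b i) *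
      ⟪fderiv ℝ (u z.1) z.2 (b i), u z.1 z.2⟫)
      (((volume : Measure ℝ).restrict (Ioo s t)).prod (volume : Measure E)) :=
    integrable_prod_of_continuousOn hc (continuousOn_finsetSum _ fun i _ =>
      (cDφ.clm_apply continuousOn_const).mul ((cDu.clm_apply continuousOn_const).inner cu))
      fun τ _ x hx => by simp [hDφK x hx]
  have i4 : Integrable (fun z : ℝ × E => p z.1 z.2 * fderiv ℝ φ z.2 (u z.1 z.2))
      (((volume : Measure ℝ).restrict (Ioo s t)).prod (volume : Measure E)) :=
    integrable_prod_of_continuousOn hc (cp.mul (cDφ.clm_apply cu)) fun τ _ x hx => by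
      simp [hDφK x hx]
  have i5 : Integrable (fun z : ℝ × E => φ z.2 * ⟪f z.1 z.2, u z.1 z.2⟫)
      (((volume : Measure ℝ).restrict (Ioo s t)).prod (volume : Measure E)) :=
    integrable_prod_of_continuousOn hc (cφ.mul (cf.inner cu)) fun τ _ x hx => by simp [hφK x hx]
  have j1 := i1.integral_prod_left
  have j2 := i2.integral_prod_left
  have j3 := i3.integral_prod_left
  have j4 := i4.integral_prod_left
  have j5 := i5.integral_prod_left
  simp only at j1 j2 j3 j4 j5
  -- the slice identity for `τ ∈ (s, t)`
  have hslice : ∀ τ ∈ Ioo s t, ∫ x, φ x * ⟪timeDerivWithin (Icc 0 T) u τ x, u τ x⟫ =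
      2⁻¹ * (∫ x, fderiv ℝ φ x (u τ x) * ‖u τ x‖ ^ 2)
      - ν * (∫ x, φ x * frobeniusNormSq (fderiv ℝ (u τ) x))
      - ν * (∫ x, ∑ i, fderiv ℝ φ x (b i) * ⟪fderiv ℝ (u τ) x (b i), u τ x⟫)
      + (∫ x, p τ x * fderiv ℝ φ x (u τ x))
      + ∫ x, φ x * ⟪f τ x, u τ x⟫ := fun τ hτ =>
    h.integral_cutoff_inner_timeDerivWithin hU ⟨hs.trans hτ.1.le, hτ.2.le.trans ht⟩ hφ hc
  have k1 : Integrable (fun τ => 2⁻¹ * ∫ x, fderiv ℝ φ x (u τ x) * ‖u τ x‖ ^ 2)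
      ((volume : Measure ℝ).restrict (Ioo s t)) := j1.const_mul _
  have k2 : Integrable (fun τ => ν * ∫ x, φ x * frobeniusNormSq (fderiv ℝ (u τ) x))
      ((volume : Measure ℝ).restrict (Ioo s t)) := j2.const_mul _
  have k3 : Integrable (fun τ => ν * ∫ x, ∑ i, fderiv ℝ φ x (b i) *
      ⟪fderiv ℝ (u τ) x (b i), u τ x⟫) ((volume : Measure ℝ).restrict (Ioo s t)) := j3.const_mul _
  have k12 : Integrable (fun τ => 2⁻¹ * (∫ x, fderiv ℝ φ x (u τ x) * ‖u τ x‖ ^ 2)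
      - ν * ∫ x, φ x * frobeniusNormSq (fderiv ℝ (u τ) x))
      ((volume : Measure ℝ).restrict (Ioo s t)) := k1.sub k2
  have k123 : Integrable (fun τ => 2⁻¹ * (∫ x, fderiv ℝ φ x (u τ x) * ‖u τ x‖ ^ 2)
      - ν * (∫ x, φ x * frobeniusNormSq (fderiv ℝ (u τ) x))
      - ν * ∫ x, ∑ i, fderiv ℝ φ x (b i) * ⟪fderiv ℝ (u τ) x (b i), u τ x⟫)
      ((volume : Measure ℝ).restrict (Ioo s t)) := k12.sub k3
  have k1234 : Integrable (fun τ => 2⁻¹ * (∫ x, fderiv ℝ φ x (u τ x) * ‖u τ x‖ ^ 2)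
      - ν * (∫ x, φ x * frobeniusNormSq (fderiv ℝ (u τ) x))
      - ν * (∫ x, ∑ i, fderiv ℝ φ x (b i) * ⟪fderiv ℝ (u τ) x (b i), u τ x⟫)
      + ∫ x, p τ x * fderiv ℝ φ x (u τ x))
      ((volume : Measure ℝ).restrict (Ioo s t)) := k123.add j4
  rw [setIntegral_congr_fun measurableSet_Ioo hslice, integral_add k1234 j5, integral_add k123 j4,
    integral_sub k12 k3, integral_sub k1 k2, integral_const_mul, integral_const_mul,
    integral_const_mul]

/-- **The energy equality for classical solutions** (Leray 1934, §17, (3.4) p. 220, "relation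
de dissipation de l'énergie" `ν ∫_{t₀}^t J²(t') dt' + ½ W(t) = ½ W(t₀)`, here with a force).
Let `(u, p)` be a classical solution on `[0, T]`, `T > 0`, with `u(τ) ∈ L²` and
`∫ |u(τ)|² ≤ M < ∞` for `τ ∈ [0, T]`, `∇u ∈ L²((0,T) × E)`, `u ∈ L³((0,T) × E)`,
`p u, ⟪f, u⟫ ∈ L¹((0,T) × E)`. Then for `0 ≤ s ≤ t ≤ T`,
`½‖u(t)‖₂² + ν ∫ₛᵗ ∫ |∇u|² = ½‖u(s)‖₂² + ∫ₛᵗ ∫ ⟪f, u⟫`.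
Proof: apply `energy_balance_cutoff` to the cut-offs `φ_R = Fluid.cutoff R`, `R = n + 1`, and
let `n → ∞`: the terms carrying `Dφ_R = O(1/R)` are `O(1/R)` by the `L³`, `L²`-gradient/energy
and `L¹` hypotheses, the remaining ones converge by dominated convergence
(Galdi 2000, Thm. 4.1; Ożański–Pooley 2018, Thm. 1.7). [cite: Leray1934, §17 (3.4) p. 220] -/
theorem IsClassicalNSSolutionOn.energyEq (h : IsClassicalNSSolutionOn (Icc 0 T) ν f u p)
    (hT : 0 < T) (hmem : ∀ τ ∈ Icc 0 T, MemLp (u τ) 2 volume) {M : ℝ≥0∞} (hMt : M ≠ ∞)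
    (hM : ∀ τ ∈ Icc 0 T, eEnergy (u τ) ≤ M)
    (hgrad : ∫⁻ τ in Ioo 0 T, ∫⁻ x, ENNReal.ofReal (frobeniusNormSq (fderiv ℝ (u τ) x)) < ∞)
    (hu₃ : ∫⁻ τ in Ioo 0 T, ∫⁻ x, ‖u τ x‖ₑ ^ (3 : ℕ) < ∞)
    (hp : ∫⁻ τ in Ioo 0 T, ∫⁻ x, ‖p τ x‖ₑ * ‖u τ x‖ₑ < ∞)
    (hf : ∫⁻ τ in Ioo 0 T, ∫⁻ x, ‖f τ x‖ₑ * ‖u τ x‖ₑ < ∞)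
    {s t : ℝ} (hs : 0 ≤ s) (hst : s ≤ t) (ht : t ≤ T) :
    VectorCalculus.kineticEnergy (u t) +
      ν * (∫⁻ τ in Ioo s t, ∫⁻ x, ENNReal.ofReal (frobeniusNormSq (fderiv ℝ (u τ) x))).toReal =
      VectorCalculus.kineticEnergy (u s) + ∫ τ in s..t, ∫ x, ⟪f τ x, u τ x⟫ := by
  set b := stdOrthonormalBasis ℝ E
  have hU : UniqueDiffOn ℝ (Icc 0 T) := uniqueDiffOn_Icc hT
  have htI : t ∈ Icc 0 T := ⟨hs.trans hst, ht⟩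
  have hsI : s ∈ Icc 0 T := ⟨hs, hst.trans ht⟩
  have hIcc : ∀ {τ}, τ ∈ Ioo s t → τ ∈ Icc 0 T := fun hτ => ⟨hs.trans hτ.1.le, hτ.2.le.trans ht⟩
  -- joint continuity on `[s, t] × E`
  have hsub : Icc s t ×ˢ (univ : Set E) ⊆ Icc 0 T ×ˢ univ :=
    prod_mono (Icc_subset_Icc hs ht) Subset.rfl
  have cu : ContinuousOn (fun z : ℝ × E => u z.1 z.2) (Icc s t ×ˢ univ) :=
    h.smooth_velocity.continuousOn.mono hsub
  have cDu : ContinuousOn (fun z : ℝ × E => fderiv ℝ (u z.1) z.2) (Icc s t ×ˢ univ) :=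
    (h.smooth_velocity.fderiv_slice hU).continuousOn.mono hsub
  have cf : ContinuousOn (fun z : ℝ × E => f z.1 z.2) (Icc s t ×ˢ univ) :=
    (h.continuousOn_force hU).mono hsub
  -- the cut-offs `φ n = χ(· / (n + 1))`
  obtain ⟨C, hC0, hC⟩ := exists_norm_fderiv_cutoff_le (E := E)
  have hRpos : ∀ n : ℕ, (0 : ℝ) < n + 1 := fun n => Nat.cast_add_one_pos n
  set φ : ℕ → E → ℝ := fun n => cutoff ((n : ℝ) + 1) with hφdef
  have hφ1 : ∀ n, ContDiff ℝ 1 (φ n) := fun n => contDiff_cutoff _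
  have hφc : ∀ n, HasCompactSupport (φ n) := fun n => hasCompactSupport_cutoff (hRpos n)
  have hφle : ∀ n x, |φ n x| ≤ 1 := fun n x => abs_cutoff_le_one _ _
  have hφlim : ∀ x, Tendsto (fun n => φ n x) atTop (𝓝 1) := fun x =>
    tendsto_cutoff_natCast_add_one x
  have hDφ : ∀ n x, ‖fderiv ℝ (φ n) x‖ ≤ C / ((n : ℝ) + 1) := fun n x => hC _ (hRpos n) x
  have hDφv : ∀ n x v, |fderiv ℝ (φ n) x v| ≤ C / ((n : ℝ) + 1) * ‖v‖ := fun n x v => by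
    rw [← Real.norm_eq_abs]
    exact (ContinuousLinearMap.le_opNorm _ _).trans (mul_le_mul_of_nonneg_right (hDφ n x)
      (norm_nonneg _))
  have hc' : ∀ n : ℕ, (0 : ℝ) ≤ C / ((n : ℝ) + 1) := fun n => div_nonneg hC0 (hRpos n).le
  have hrate : ∀ K : ℝ, Tendsto (fun n : ℕ => K * (1 / ((n : ℝ) + 1))) atTop (𝓝 0) := fun K => by
    simpa using (tendsto_one_div_add_atTop_nhds_zero_nat (𝕜 := ℝ)).const_mul K
  -- the identity for each `n`
  have hid := fun n => h.energy_balance_cutoff hT (hφ1 n) (hφc n) hs hst ht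
  -- (a) the kinetic terms
  have limE : ∀ {r}, r ∈ Icc 0 T →
      Tendsto (fun n => 2⁻¹ * ∫ x, φ n x * ‖u r x‖ ^ 2) atTop (𝓝 (VectorCalculus.kineticEnergy (u r))) := by
    intro r hr
    have hur : Continuous (u r) := (h.contDiff_velocity hr).continuous
    refine Tendsto.const_mul _ (tendsto_integral_of_dominated_convergence (fun x => ‖u r x‖ ^ 2)
      ?_ ((hmem r hr).integrable_norm_pow two_ne_zero) ?_ ?_)
    · exact fun n => ((hφ1 n).continuous.mul (hur.norm.pow 2)).aestronglyMeasurable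
    · refine fun n => Eventually.of_forall fun x => ?_
      rw [Real.norm_eq_abs, abs_mul, abs_of_nonneg (sq_nonneg ‖u r x‖)]
      exact mul_le_of_le_one_left (sq_nonneg _) (hφle n x)
    · exact Eventually.of_forall fun x => by simpa using (hφlim x).mul_const (‖u r x‖ ^ 2)
  -- (b) the transported kinetic energy `½ ∫∫ (Dφ·u)|u|²` is `O(1/R)`
  have lim1 : Tendsto (fun n => ∫ τ in Ioo s t, ∫ x, fderiv ℝ (φ n) x (u τ x) * ‖u τ x‖ ^ 2)
      atTop (𝓝 0) := by
    set L := ∫⁻ τ in Ioo 0 T, ∫⁻ x, ‖u τ x‖ₑ ^ (3 : ℕ) with hL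
    have hLt : L ≠ ∞ := hu₃.ne
    refine squeeze_zero_norm (a := fun n : ℕ => C * L.toReal * (1 / ((n : ℝ) + 1)))
      (fun n => ?_) (hrate _)
    have hpt : ∀ τ x, ‖fderiv ℝ (φ n) x (u τ x) * ‖u τ x‖ ^ 2‖ₑ ≤
        ENNReal.ofReal (C / ((n : ℝ) + 1)) * ‖u τ x‖ₑ ^ (3 : ℕ) := fun τ x => by
      rw [Real.enorm_eq_ofReal_abs, ← ofReal_norm, ← ENNReal.ofReal_pow (norm_nonneg _),
        ← ENNReal.ofReal_mul (hc' n)]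
      refine ENNReal.ofReal_le_ofReal ?_
      rw [abs_mul, abs_of_nonneg (sq_nonneg ‖u τ x‖)]
      calc |fderiv ℝ (φ n) x (u τ x)| * ‖u τ x‖ ^ 2
          ≤ C / ((n : ℝ) + 1) * ‖u τ x‖ * ‖u τ x‖ ^ 2 := by gcongr; exact hDφv n x _
        _ = C / ((n : ℝ) + 1) * ‖u τ x‖ ^ 3 := by ring
    have hle : ∫⁻ τ in Ioo s t, ∫⁻ x, ‖fderiv ℝ (φ n) x (u τ x) * ‖u τ x‖ ^ 2‖ₑ ≤
        ENNReal.ofReal (C / ((n : ℝ) + 1)) * L := by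
      calc ∫⁻ τ in Ioo s t, ∫⁻ x, ‖fderiv ℝ (φ n) x (u τ x) * ‖u τ x‖ ^ 2‖ₑ
          ≤ ∫⁻ τ in Ioo s t, ∫⁻ x, ENNReal.ofReal (C / ((n : ℝ) + 1)) * ‖u τ x‖ₑ ^ (3 : ℕ) :=
            lintegral_mono fun τ => lintegral_mono fun x => hpt τ x
        _ = ENNReal.ofReal (C / ((n : ℝ) + 1)) * ∫⁻ τ in Ioo s t, ∫⁻ x, ‖u τ x‖ₑ ^ (3 : ℕ) := by
            simp only [lintegral_const_mul' _ _ ENNReal.ofReal_ne_top]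
        _ ≤ ENNReal.ofReal (C / ((n : ℝ) + 1)) * L :=
            mul_le_mul_right (lintegral_Ioo_mono hs ht) _
    refine (norm_integral_integral_le_of_lintegral_le
      (G := fun z : ℝ × E => fderiv ℝ (φ n) z.2 (u z.1 z.2) * ‖u z.1 z.2‖ ^ 2)
      (ENNReal.mul_ne_top ENNReal.ofReal_ne_top hLt) hle).trans_eq ?_
    rw [ENNReal.toReal_mul, ENNReal.toReal_ofReal (hc' n)]
    ring
  -- (c) the viscous cross term `ν ∫∫ Σᵢ ∂ᵢφ ⟪∂ᵢu, u⟫` is `O(1/R)` (Young's inequality)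
  have lim3 : Tendsto (fun n => ∫ τ in Ioo s t, ∫ x, ∑ i, fderiv ℝ (φ n) x (b i) *
      ⟪fderiv ℝ (u τ) x (b i), u τ x⟫) atTop (𝓝 0) := by
    set Lg := ∫⁻ τ in Ioo 0 T, ∫⁻ x, ENNReal.ofReal (frobeniusNormSq (fderiv ℝ (u τ) x)) with hLg
    set d : ℕ := (Finset.univ : Finset (Fin (Module.finrank ℝ E))).card with hd
    set B : ℝ≥0∞ := Lg + (d : ℝ≥0∞) * M * ENNReal.ofReal T with hB
    have hBt : B ≠ ∞ := ENNReal.add_ne_top.2 ⟨hgrad.ne, ENNReal.mul_ne_top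
      (ENNReal.mul_ne_top (ENNReal.natCast_ne_top d) hMt) ENNReal.ofReal_ne_top⟩
    refine squeeze_zero_norm (a := fun n : ℕ => C * B.toReal * (1 / ((n : ℝ) + 1)))
      (fun n => ?_) (hrate _)
    -- pointwise Young bound
    have hpt : ∀ τ x, ‖∑ i, fderiv ℝ (φ n) x (b i) * ⟪fderiv ℝ (u τ) x (b i), u τ x⟫‖ₑ ≤
        ENNReal.ofReal (C / ((n : ℝ) + 1)) *
          (ENNReal.ofReal (frobeniusNormSq (fderiv ℝ (u τ) x)) + d * ‖u τ x‖ₑ ^ 2) := by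
      intro τ x
      have hreal : |∑ i, fderiv ℝ (φ n) x (b i) * ⟪fderiv ℝ (u τ) x (b i), u τ x⟫| ≤
          C / ((n : ℝ) + 1) * (frobeniusNormSq (fderiv ℝ (u τ) x) + d * ‖u τ x‖ ^ 2) := by
        calc |∑ i, fderiv ℝ (φ n) x (b i) * ⟪fderiv ℝ (u τ) x (b i), u τ x⟫|
            ≤ ∑ i, |fderiv ℝ (φ n) x (b i) * ⟪fderiv ℝ (u τ) x (b i), u τ x⟫| :=
              Finset.abs_sum_le_sum_abs _ _
          _ ≤ ∑ i, C / ((n : ℝ) + 1) * (‖fderiv ℝ (u τ) x (b i)‖ ^ 2 + ‖u τ x‖ ^ 2) := by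
              refine Finset.sum_le_sum fun i _ => ?_
              rw [abs_mul]
              have h1 : |fderiv ℝ (φ n) x (b i)| ≤ C / ((n : ℝ) + 1) := by
                simpa [b.orthonormal.1 i] using hDφv n x (b i)
              have h2 : |⟪fderiv ℝ (u τ) x (b i), u τ x⟫| ≤
                  ‖fderiv ℝ (u τ) x (b i)‖ ^ 2 + ‖u τ x‖ ^ 2 :=
                (abs_real_inner_le_norm _ _).trans (by
                  nlinarith [sq_nonneg (‖fderiv ℝ (u τ) x (b i)‖ - ‖u τ x‖),
                    norm_nonneg (fderiv ℝ (u τ) x (b i)), norm_nonneg (u τ x)])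
              exact mul_le_mul h1 h2 (abs_nonneg _) (hc' n)
          _ = C / ((n : ℝ) + 1) * (frobeniusNormSq (fderiv ℝ (u τ) x) + d * ‖u τ x‖ ^ 2) := by
              rw [← Finset.mul_sum, Finset.sum_add_distrib, Finset.sum_const, nsmul_eq_mul,
                frobeniusNormSq_eq_sum b]
      rw [Real.enorm_eq_ofReal_abs]
      refine (ENNReal.ofReal_le_ofReal hreal).trans_eq ?_
      rw [ENNReal.ofReal_mul (hc' n), ENNReal.ofReal_add (frobeniusNormSq_nonneg _) (by positivity),
        ENNReal.ofReal_mul (Nat.cast_nonneg _), ENNReal.ofReal_natCast, ← ofReal_norm,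
        ← ENNReal.ofReal_pow (norm_nonneg _)]
    -- inner integrals, `τ ∈ (s, t)`
    have hin : ∀ τ ∈ Ioo s t,
        ∫⁻ x, ‖∑ i, fderiv ℝ (φ n) x (b i) * ⟪fderiv ℝ (u τ) x (b i), u τ x⟫‖ₑ ≤
          ENNReal.ofReal (C / ((n : ℝ) + 1)) *
            ((∫⁻ x, ENNReal.ofReal (frobeniusNormSq (fderiv ℝ (u τ) x))) + d * M) := by
      intro τ hτ
      have hτI := hIcc hτ
      have hmeas : AEMeasurable (fun x => ENNReal.ofReal (frobeniusNormSq (fderiv ℝ (u τ) x)))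
          (volume : Measure E) :=
        (ENNReal.continuous_ofReal.comp (LerayHopfProofs.continuous_frobeniusNormSq.comp
          ((h.contDiff_velocity hτI).continuous_fderiv (by simp)))).aemeasurable
      calc ∫⁻ x, ‖∑ i, fderiv ℝ (φ n) x (b i) * ⟪fderiv ℝ (u τ) x (b i), u τ x⟫‖ₑ
          ≤ ∫⁻ x, ENNReal.ofReal (C / ((n : ℝ) + 1)) *
              (ENNReal.ofReal (frobeniusNormSq (fderiv ℝ (u τ) x)) + d * ‖u τ x‖ₑ ^ 2) :=
            lintegral_mono fun x => hpt τ x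
        _ = ENNReal.ofReal (C / ((n : ℝ) + 1)) *
              ((∫⁻ x, ENNReal.ofReal (frobeniusNormSq (fderiv ℝ (u τ) x))) +
                d * ∫⁻ x, ‖u τ x‖ₑ ^ 2) := by
            rw [lintegral_const_mul' _ _ ENNReal.ofReal_ne_top, lintegral_add_left' hmeas,
              lintegral_const_mul' _ _ (ENNReal.natCast_ne_top d)]
        _ ≤ ENNReal.ofReal (C / ((n : ℝ) + 1)) *
              ((∫⁻ x, ENNReal.ofReal (frobeniusNormSq (fderiv ℝ (u τ) x))) + d * M) := by
            gcongr
            exact hM τ hτI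
    have hle : ∫⁻ τ in Ioo s t,
        ∫⁻ x, ‖∑ i, fderiv ℝ (φ n) x (b i) * ⟪fderiv ℝ (u τ) x (b i), u τ x⟫‖ₑ ≤
          ENNReal.ofReal (C / ((n : ℝ) + 1)) * B := by
      calc ∫⁻ τ in Ioo s t, ∫⁻ x, ‖∑ i, fderiv ℝ (φ n) x (b i) * ⟪fderiv ℝ (u τ) x (b i), u τ x⟫‖ₑ
          ≤ ∫⁻ τ in Ioo s t, ENNReal.ofReal (C / ((n : ℝ) + 1)) *
              ((∫⁻ x, ENNReal.ofReal (frobeniusNormSq (fderiv ℝ (u τ) x))) + d * M) :=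
            setLIntegral_mono' measurableSet_Ioo hin
        _ = ENNReal.ofReal (C / ((n : ℝ) + 1)) *
              ((∫⁻ τ in Ioo s t, ∫⁻ x, ENNReal.ofReal (frobeniusNormSq (fderiv ℝ (u τ) x))) +
                d * M * volume (Ioo s t)) := by
            rw [lintegral_const_mul' _ _ ENNReal.ofReal_ne_top, lintegral_add_right _ measurable_const,
              setLIntegral_const]
        _ ≤ ENNReal.ofReal (C / ((n : ℝ) + 1)) * B := by
            rw [hB, Real.volume_Ioo]
            gcongr
            · exact lintegral_Ioo_mono hs ht
            · linarith
    refine (norm_integral_integral_le_of_lintegral_le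
      (G := fun z : ℝ × E => ∑ i, fderiv ℝ (φ n) z.2 (b i) * ⟪fderiv ℝ (u z.1) z.2 (b i), u z.1 z.2⟫)
      (ENNReal.mul_ne_top ENNReal.ofReal_ne_top hBt) hle).trans_eq ?_
    rw [ENNReal.toReal_mul, ENNReal.toReal_ofReal (hc' n)]
    ring
  -- (d) the pressure flux `∫∫ p (Dφ·u)` is `O(1/R)`
  have lim4 : Tendsto (fun n => ∫ τ in Ioo s t, ∫ x, p τ x * fderiv ℝ (φ n) x (u τ x))
      atTop (𝓝 0) := by
    set L := ∫⁻ τ in Ioo 0 T, ∫⁻ x, ‖p τ x‖ₑ * ‖u τ x‖ₑ with hL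
    have hLt : L ≠ ∞ := hp.ne
    refine squeeze_zero_norm (a := fun n : ℕ => C * L.toReal * (1 / ((n : ℝ) + 1)))
      (fun n => ?_) (hrate _)
    have hpt : ∀ τ x, ‖p τ x * fderiv ℝ (φ n) x (u τ x)‖ₑ ≤
        ENNReal.ofReal (C / ((n : ℝ) + 1)) * (‖p τ x‖ₑ * ‖u τ x‖ₑ) := fun τ x => by
      rw [enorm_mul, mul_left_comm]
      gcongr
      rw [Real.enorm_eq_ofReal_abs, ← ofReal_norm, ← ENNReal.ofReal_mul (hc' n)]
      exact ENNReal.ofReal_le_ofReal (hDφv n x _)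
    have hle : ∫⁻ τ in Ioo s t, ∫⁻ x, ‖p τ x * fderiv ℝ (φ n) x (u τ x)‖ₑ ≤
        ENNReal.ofReal (C / ((n : ℝ) + 1)) * L := by
      calc ∫⁻ τ in Ioo s t, ∫⁻ x, ‖p τ x * fderiv ℝ (φ n) x (u τ x)‖ₑ
          ≤ ∫⁻ τ in Ioo s t, ∫⁻ x, ENNReal.ofReal (C / ((n : ℝ) + 1)) * (‖p τ x‖ₑ * ‖u τ x‖ₑ) :=
            lintegral_mono fun τ => lintegral_mono fun x => hpt τ x
        _ = ENNReal.ofReal (C / ((n : ℝ) + 1)) * ∫⁻ τ in Ioo s t, ∫⁻ x, ‖p τ x‖ₑ * ‖u τ x‖ₑ := by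
            simp only [lintegral_const_mul' _ _ ENNReal.ofReal_ne_top]
        _ ≤ ENNReal.ofReal (C / ((n : ℝ) + 1)) * L :=
            mul_le_mul_right (lintegral_Ioo_mono hs ht) _
    refine (norm_integral_integral_le_of_lintegral_le
      (G := fun z : ℝ × E => p z.1 z.2 * fderiv ℝ (φ n) z.2 (u z.1 z.2))
      (ENNReal.mul_ne_top ENNReal.ofReal_ne_top hLt) hle).trans_eq ?_
    rw [ENNReal.toReal_mul, ENNReal.toReal_ofReal (hc' n)]
    ring
  -- (e) the dissipation `ν ∫∫ φ |∇u|² → ν ∫∫ |∇u|²` (dominated convergence on `(s, t) × E`)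
  set μ : Measure (ℝ × E) := ((volume : Measure ℝ).restrict (Ioo s t)).prod (volume : Measure E)
    with hμ
  have lim2 : Tendsto (fun n => ∫ τ in Ioo s t, ∫ x, φ n x * frobeniusNormSq (fderiv ℝ (u τ) x))
      atTop (𝓝 ((∫⁻ τ in Ioo s t, ∫⁻ x,
        ENNReal.ofReal (frobeniusNormSq (fderiv ℝ (u τ) x))).toReal)) := by
    have cG : ContinuousOn (fun z : ℝ × E => frobeniusNormSq (fderiv ℝ (u z.1) z.2))
        (Icc s t ×ˢ univ) := LerayHopfProofs.continuous_frobeniusNormSq.comp_continuousOn cDu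
    have hG : Integrable (fun z : ℝ × E => frobeniusNormSq (fderiv ℝ (u z.1) z.2)) μ := by
      refine integrable_prod_of_continuousOn_of_lintegral cG ?_
      calc ∫⁻ τ in Ioo s t, ∫⁻ x, ‖frobeniusNormSq (fderiv ℝ (u τ) x)‖ₑ
          = ∫⁻ τ in Ioo s t, ∫⁻ x, ENNReal.ofReal (frobeniusNormSq (fderiv ℝ (u τ) x)) := by
            simp only [Real.enorm_eq_ofReal (frobeniusNormSq_nonneg _)]
        _ ≤ ∫⁻ τ in Ioo 0 T, ∫⁻ x, ENNReal.ofReal (frobeniusNormSq (fderiv ℝ (u τ) x)) :=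
            lintegral_Ioo_mono hs ht
        _ < ∞ := hgrad
    have hFn : ∀ n, Integrable (fun z : ℝ × E => φ n z.2 * frobeniusNormSq (fderiv ℝ (u z.1) z.2))
        μ := fun n =>
      hG.mono' (aestronglyMeasurable_prod_of_continuousOn
        ((((hφ1 n).continuous.comp continuous_snd).continuousOn).mul cG))
        (Eventually.of_forall fun z => by
          rw [norm_mul, Real.norm_eq_abs, Real.norm_of_nonneg (frobeniusNormSq_nonneg _)]
          exact mul_le_of_le_one_left (frobeniusNormSq_nonneg _) (hφle n _))
    have hval : ∀ n, ∫ τ in Ioo s t, ∫ x, φ n x * frobeniusNormSq (fderiv ℝ (u τ) x) =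
        ∫ z, φ n z.2 * frobeniusNormSq (fderiv ℝ (u z.1) z.2) ∂μ := fun n =>
      (integral_prod _ (hFn n)).symm
    have hlimval : (∫⁻ τ in Ioo s t, ∫⁻ x, ENNReal.ofReal (frobeniusNormSq (fderiv ℝ (u τ) x))).toReal
        = ∫ z, frobeniusNormSq (fderiv ℝ (u z.1) z.2) ∂μ := by
      rw [integral_eq_lintegral_of_nonneg_ae (Eventually.of_forall fun z => frobeniusNormSq_nonneg _)
        hG.aestronglyMeasurable, lintegral_prod _ hG.aestronglyMeasurable.aemeasurable.ennreal_ofReal]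
    rw [hlimval]
    refine (tendsto_integral_of_dominated_convergence
      (fun z : ℝ × E => frobeniusNormSq (fderiv ℝ (u z.1) z.2))
      (fun n => (hFn n).aestronglyMeasurable) hG (fun n => Eventually.of_forall fun z => ?_)
      (Eventually.of_forall fun z => ?_)).congr fun n => (hval n).symm
    · rw [norm_mul, Real.norm_eq_abs, Real.norm_of_nonneg (frobeniusNormSq_nonneg _)]
      exact mul_le_of_le_one_left (frobeniusNormSq_nonneg _) (hφle n _)
    · simpa using (hφlim z.2).mul_const (frobeniusNormSq (fderiv ℝ (u z.1) z.2))
  -- (f) the work of the force `∫∫ φ ⟪f, u⟫ → ∫∫ ⟪f, u⟫` (dominated convergence)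
  have lim5 : Tendsto (fun n => ∫ τ in Ioo s t, ∫ x, φ n x * ⟪f τ x, u τ x⟫) atTop
      (𝓝 (∫ τ in Ioo s t, ∫ x, ⟪f τ x, u τ x⟫)) := by
    have cG : ContinuousOn (fun z : ℝ × E => ⟪f z.1 z.2, u z.1 z.2⟫) (Icc s t ×ˢ univ) :=
      cf.inner cu
    have hBd : Integrable (fun z : ℝ × E => ‖f z.1 z.2‖ * ‖u z.1 z.2‖) μ := by
      refine integrable_prod_of_continuousOn_of_lintegral (cf.norm.mul cu.norm) ?_
      calc ∫⁻ τ in Ioo s t, ∫⁻ x, ‖‖f τ x‖ * ‖u τ x‖‖ₑ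
          = ∫⁻ τ in Ioo s t, ∫⁻ x, ‖f τ x‖ₑ * ‖u τ x‖ₑ := by simp only [enorm_mul, enorm_norm]
        _ ≤ ∫⁻ τ in Ioo 0 T, ∫⁻ x, ‖f τ x‖ₑ * ‖u τ x‖ₑ := lintegral_Ioo_mono hs ht
        _ < ∞ := hf
    have hG : Integrable (fun z : ℝ × E => ⟪f z.1 z.2, u z.1 z.2⟫) μ :=
      hBd.mono' (aestronglyMeasurable_prod_of_continuousOn cG)
        (Eventually.of_forall fun z => norm_inner_le_norm _ _)
    have hbd : ∀ n (z : ℝ × E), ‖φ n z.2 * ⟪f z.1 z.2, u z.1 z.2⟫‖ ≤ ‖f z.1 z.2‖ * ‖u z.1 z.2‖ :=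
      fun n z => by
        rw [norm_mul, Real.norm_eq_abs]
        exact (mul_le_mul (hφle n _) (norm_inner_le_norm _ _) (norm_nonneg _) zero_le_one).trans_eq
          (one_mul _)
    have hFn : ∀ n, Integrable (fun z : ℝ × E => φ n z.2 * ⟪f z.1 z.2, u z.1 z.2⟫) μ := fun n =>
      hBd.mono' (aestronglyMeasurable_prod_of_continuousOn
        ((((hφ1 n).continuous.comp continuous_snd).continuousOn).mul cG))
        (Eventually.of_forall (hbd n))
    have hval : ∀ n, ∫ τ in Ioo s t, ∫ x, φ n x * ⟪f τ x, u τ x⟫ =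
        ∫ z, φ n z.2 * ⟪f z.1 z.2, u z.1 z.2⟫ ∂μ := fun n => (integral_prod _ (hFn n)).symm
    rw [← integral_prod _ hG]
    refine (tendsto_integral_of_dominated_convergence
      (fun z : ℝ × E => ‖f z.1 z.2‖ * ‖u z.1 z.2‖)
      (fun n => (hFn n).aestronglyMeasurable) hBd (fun n => Eventually.of_forall (hbd n))
      (Eventually.of_forall fun z => ?_)).congr fun n => (hval n).symm
    simpa using (hφlim z.2).mul_const ⟪f z.1 z.2, u z.1 z.2⟫
  -- (g) pass to the limit in the identity
  have hLHS := (limE htI).sub (limE hsI)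
  have hRHS := ((((lim1.const_mul (2⁻¹ : ℝ)).sub (lim2.const_mul ν)).sub (lim3.const_mul ν)).add
    lim4).add lim5
  have heq := tendsto_nhds_unique hLHS (hRHS.congr fun n => (hid n).symm)
  rw [intervalIntegral.integral_of_le hst, integral_Ioc_eq_integral_Ioo]
  linarith

end Energy

/-! ### `C([0,T]; L²)`: energy bound and weak continuity -/

section LpContinuity

variable {X : Type*} [MeasureSpace X]
variable {F : Type*} [NormedAddCommGroup F]

/-- **Lift to `L²`.** A field `u ∈ C(S; L^q)` (`ContinuousInLpOn S q u`) defines a map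
`U : ℝ → L^q` continuous on `S` with `U t = [u t]` for `t ∈ S` (Robinson–Rodrigo–Sadowski 2016,
§1.7: `C([0,T]; X)` as continuous `X`-valued maps). [cite: RobinsonRodrigoSadowski2016, §1.7] -/
theorem ContinuousInLpOn.exists_continuousOn_toLp {S : Set ℝ} {q : ℝ≥0∞} [Fact (1 ≤ q)]
    {u : ℝ → X → F} (hu : ContinuousInLpOn S q u) :
    ∃ U : ℝ → Lp F q (volume : Measure X), ContinuousOn U S ∧
      ∀ t (ht : t ∈ S), U t = (hu.1 t ht).toLp (u t) := by
  classical
  refine ⟨fun t => if ht : t ∈ S then (hu.1 t ht).toLp (u t) else 0, fun t₀ ht₀ => ?_,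
    fun t ht => dif_pos ht⟩
  rw [ContinuousWithinAt, tendsto_iff_norm_sub_tendsto_zero]
  have hev : ∀ᶠ t in 𝓝[S] t₀, (eLpNorm (u t - u t₀) q volume).toReal =
      ‖(if ht : t ∈ S then (hu.1 t ht).toLp (u t) else 0) -
        (if ht : t₀ ∈ S then (hu.1 t₀ ht).toLp (u t₀) else 0)‖ :=
    eventually_mem_nhdsWithin.mono fun t ht => by
      rw [dif_pos ht, dif_pos ht₀, ← MemLp.toLp_sub, Lp.norm_toLp]
  refine Tendsto.congr' hev ?_
  rw [← ENNReal.toReal_zero]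
  exact (ENNReal.tendsto_toReal ENNReal.zero_ne_top).comp (hu.2 t₀ ht₀)

end LpContinuity

section Assembly

variable {E : Type*} [NormedAddCommGroup E] [InnerProductSpace ℝ E] [FiniteDimensional ℝ E]
  [MeasurableSpace E] [BorelSpace E]

/-- The extended energy is the square of the `L²` (semi)norm: `∫⁻ ‖v‖ₑ² = ‖v‖_{L²}²`. [folklore] -/
theorem eEnergy_eq_eLpNorm_sq (v : E → E) : eEnergy v = eLpNorm v 2 (volume : Measure E) ^ 2 := by
  have h := eLpNorm_nnreal_pow_eq_lintegral (f := v) (μ := (volume : Measure E)) (p := (2 : ℝ≥0))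
    two_ne_zero
  simp only [ENNReal.coe_ofNat, NNReal.coe_ofNat, ENNReal.rpow_two] at h
  rw [eEnergy, h]

variable {T ν : ℝ} {f u : ℝ → E → E} {p : ℝ → E → ℝ}

/-- **Regular solutions are turbulent solutions** (Leray 1934, §32 p. 242: "Il est tout d'abord
évident que toute solution régulière constitue a fortiori une solution turbulente"): discharge of
the named fact `Literature.Analysis.FluidPDE.IsClassicalNSSolutionOn.isLerayHopfOn`. A classical solution on
`S ⊇ [0, T]`, `T > 0`, with `u ∈ C([0,T]; L²)`, `∇u ∈ L²_{t,x}`, `u ∈ L³_{t,x}`,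
`p u, ⟪f, u⟫ ∈ L¹_{t,x}` is a Leray–Hopf weak solution on `[0, T)` with datum `u 0`:
* the weak formulation is `IsClassicalNSSolutionOn.isWeakNSSolutionOn_holds`;
* the energy inequalities (with *equality*) are `IsClassicalNSSolutionOn.energyEq` (Leray's
  (3.4)) with the classical gradient, a weak gradient by `HasWeakGradient.of_contDiff_holds`;
* `u ∈ C([0,T]; L²)` lifts to a continuous map `[0, T] → L²`
  (`ContinuousInLpOn.exists_continuousOn_toLp`), whence the uniform energy bound (continuous
  norm on a compact interval), the weak `L²` continuity (continuity of the `L²` inner product)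
  and the strong attainment of the datum (`𝓝[>] 0 ≤ 𝓝[[0,T]] 0` as `T > 0`)
(Galdi 2000, Thm. 4.1; Robinson–Rodrigo–Sadowski 2016, Thm. 4.6). [cite: Leray1934, §32 p. 242] -/
theorem IsClassicalNSSolutionOn.isLerayHopfOn_holds :
    IsClassicalNSSolutionOn.isLerayHopfOn (E := E) (T := T) (ν := ν) (f := f) (u := u)
      (p := p) := by
  intro S h hT hS hu₂ hgrad hu₃ hp hf
  have hU : UniqueDiffOn ℝ (Icc 0 T) := uniqueDiffOn_Icc hT
  have h₀ : IsClassicalNSSolutionOn (Icc 0 T) ν f u p := h.mono hS hU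
  have h0I : (0 : ℝ) ∈ Icc 0 T := left_mem_Icc.2 hT.le
  -- `𝓝[>] 0 ≤ 𝓝[[0, T]] 0`
  have hfilter : 𝓝[>] (0 : ℝ) ≤ 𝓝[Icc 0 T] 0 :=
    nhdsWithin_le_of_mem (mem_of_superset (Ioo_mem_nhdsGT hT) Ioo_subset_Icc_self)
  -- lift to `L²`
  obtain ⟨U, hUc, hUeq⟩ := hu₂.exists_continuousOn_toLp
  have hnorm : ∀ t (ht : t ∈ Icc 0 T), eLpNorm (u t) 2 volume = ENNReal.ofReal ‖U t‖ := by
    intro t ht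
    rw [hUeq t ht, Lp.norm_toLp, ENNReal.ofReal_toReal (hu₂.1 t ht).eLpNorm_ne_top]
  -- uniform energy bound
  obtain ⟨R, hR⟩ := isCompact_Icc.exists_bound_of_continuousOn hUc
  have hM : ∀ t ∈ Icc 0 T, eEnergy (u t) ≤ ((R.toNNReal ^ 2 : ℝ≥0) : ℝ≥0∞) := by
    intro t ht
    rw [eEnergy_eq_eLpNorm_sq, hnorm t ht, ENNReal.coe_pow, ENNReal.ofReal]
    gcongr
    exact hR t ht
  -- the energy equality on every `[s, t] ⊆ [0, T]`
  have hE : ∀ {s t : ℝ}, 0 ≤ s → s ≤ t → t ≤ T → VectorCalculus.kineticEnergy (u t) +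
      ν * (∫⁻ τ in Ioo s t, ∫⁻ x, ENNReal.ofReal (frobeniusNormSq (fderiv ℝ (u τ) x))).toReal =
      VectorCalculus.kineticEnergy (u s) + ∫ τ in s..t, ∫ x, ⟪f τ x, u τ x⟫ := fun hs hst ht =>
    h₀.energyEq hT hu₂.1 ENNReal.coe_ne_top hM hgrad hu₃ hp hf hs hst ht
  -- inner products against `w ∈ L²` through the lift
  have hinner : ∀ {w : E → E} (hw : MemLp w 2 volume) (t : ℝ) (ht : t ∈ Icc 0 T),
      ∫ x, ⟪u t x, w x⟫ = ⟪U t, hw.toLp w⟫ := by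
    intro w hw t ht
    rw [MeasureTheory.L2.inner_def, hUeq t ht]
    exact integral_congr_ae (((hu₂.1 t ht).coeFn_toLp).mp ((hw.coeFn_toLp).mono
      fun x h1 h2 => by dsimp only; rw [h1, h2]))
  refine ⟨isWeakNSSolutionOn_holds h hS, ⟨R.toNNReal ^ 2, ?_⟩, hu₂.1, ⟨fun t => fderiv ℝ (u t),
    ?_, hgrad, fun t ht => (hE le_rfl ht.1 ht.2).le, ?_⟩, fun w hw => ⟨?_, ?_⟩, ?_⟩
  · -- energy bound a.e. on `(0, T)`
    exact (ae_restrict_iff' measurableSet_Ioo).2 (Eventually.of_forall fun t ht =>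
      hM t (Ioo_subset_Icc_self ht))
  · -- the classical gradient is a weak gradient
    exact (ae_restrict_iff' measurableSet_Ioo).2 (Eventually.of_forall fun t ht =>
      hasWeakGradient_fderiv_of_contDiff
        (contDiff_infty.1 (h₀.contDiff_velocity (Ioo_subset_Icc_self ht)) 1))
  · -- energy (in)equality from a.e. (indeed every) `s ∈ (0, T)`
    exact (ae_restrict_iff' measurableSet_Ioo).2 (Eventually.of_forall fun s hs t ht =>
      (hE hs.1.le ht.1 ht.2).le)
  · -- weak continuity on `(0, T]`
    have hc : ContinuousOn (fun t => ⟪U t, hw.toLp w⟫) (Icc 0 T) :=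
      hUc.inner continuousOn_const
    exact (hc.congr fun t ht => hinner hw t ht).mono Ioc_subset_Icc_self
  · -- weak attainment of the datum
    have hc : ContinuousWithinAt (fun t => ⟪U t, hw.toLp w⟫) (Icc 0 T) 0 :=
      (hUc.inner continuousOn_const) 0 h0I
    rw [hinner hw 0 h0I]
    refine ((hc.tendsto.congr' ?_).mono_left hfilter)
    exact eventually_mem_nhdsWithin.mono fun t ht => (hinner hw t ht).symm
  · -- strong attainment of the datum
    exact (hu₂.2 0 h0I).mono_left hfilter

end Assembly

/-! ### Mixed space–time classes: gluing, transfer and interpolation -/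

section MixedAPI

variable {X : Type*} [MeasureSpace X]
variable {F : Type*} [NormedAddCommGroup F]

/-- `‖f‖_{L^n}^n = ∫⁻ ‖f‖ₑ^n` for a natural exponent `n ≠ 0`. [folklore] -/
theorem eLpNorm_natCast_pow_eq_lintegral {α : Type*} {m : MeasurableSpace α} (μ : Measure α)
    (f : α → F) {n : ℕ} (hn : n ≠ 0) :
    eLpNorm f n μ ^ n = ∫⁻ x, ‖f x‖ₑ ^ n ∂μ := by
  have h := eLpNorm_nnreal_pow_eq_lintegral (f := f) (μ := μ) (p := (n : ℝ≥0))
    (by exact_mod_cast hn)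
  simp only [ENNReal.coe_natCast, NNReal.coe_natCast, ENNReal.rpow_natCast] at h
  exact h

/-- In a guarded mixed class the inner norms are a.e. bounded by the `L^∞_t` mixed norm:
`‖u t‖_{L^p} ≤ ‖u‖_{L^∞(S; L^p)}` for a.e. `t ∈ S`. [folklore] -/
theorem MemLqLp.ae_eLpNorm_le_top {p : ℝ≥0∞} {u : ℝ → X → F} {S : Set ℝ}
    (hu : MemLqLp ∞ p u S) :
    ∀ᵐ t ∂(volume.restrict S), eLpNorm (u t) p volume ≤ eLqLpNorm ∞ p u S := by
  have h := ae_le_eLpNormEssSup (μ := volume.restrict S)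
    (f := fun t => (eLpNorm (u t) p volume).toReal)
  filter_upwards [hu.1, h] with t ht ht'
  rw [Real.enorm_eq_ofReal ENNReal.toReal_nonneg, ENNReal.ofReal_toReal ht.eLpNorm_ne_top] at ht'
  rwa [eLqLpNorm, eLpNorm_exponent_top]

/-- The mixed class is finite: `‖u‖_{L^∞(S;L^p)} < ∞`. [folklore] -/
theorem MemLqLp.eLqLpNorm_lt_top {q p : ℝ≥0∞} {u : ℝ → X → F} {S : Set ℝ}
    (hu : MemLqLp q p u S) : eLqLpNorm q p u S < ∞ :=
  hu.2

/-- The mixed classes only see slices up to a.e. equality: if `u t = v t` a.e. in space for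
a.e. `t ∈ S`, then `v ∈ L^q(S; L^p)` implies `u ∈ L^q(S; L^p)`. [folklore] -/
theorem MemLqLp.congr_ae_slice {q p : ℝ≥0∞} {u v : ℝ → X → F} {S : Set ℝ}
    (hv : MemLqLp q p v S) (h : ∀ᵐ t ∂(volume.restrict S), u t =ᵐ[volume] v t) :
    MemLqLp q p u S := by
  refine ⟨?_, ?_⟩
  · filter_upwards [hv.1, h] with t ht ht'
    exact ht.ae_eq ht'.symm
  · have hae : (fun t => (eLpNorm (u t) p volume).toReal) =ᵐ[volume.restrict S]
        fun t => (eLpNorm (v t) p volume).toReal := by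
      filter_upwards [h] with t ht
      rw [eLpNorm_congr_ae ht]
    rw [eLqLpNorm, eLpNorm_congr_ae hae]
    exact hv.2

/-- The zero field lies in every mixed class. [folklore] -/
theorem memLqLp_zero (q p : ℝ≥0∞) (S : Set ℝ) : MemLqLp q p (0 : ℝ → X → F) S :=
  ⟨Eventually.of_forall fun _ => MemLp.zero, by simp⟩

/-- A field vanishing a.e. in space for a.e. `t ∈ S` lies in every mixed class on `S`. [folklore] -/
theorem memLqLp_of_ae_slice_eq_zero {q p : ℝ≥0∞} {u : ℝ → X → F} {S : Set ℝ}
    (h : ∀ᵐ t ∂(volume.restrict S), u t =ᵐ[volume] 0) : MemLqLp q p u S :=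
  (memLqLp_zero q p S).congr_ae_slice h

/-- **Gluing two time sets.** `u ∈ L^q(A; L^p)` and `u ∈ L^q(B; L^p)` give
`u ∈ L^q(A ∪ B; L^p)`. [folklore] -/
theorem MemLqLp.union {q p : ℝ≥0∞} {u : ℝ → X → F} {A B : Set ℝ}
    (hA : MemLqLp q p u A) (hB : MemLqLp q p u B) : MemLqLp q p u (A ∪ B) := by
  refine ⟨(ae_restrict_union_iff A B _).2 ⟨hA.1, hB.1⟩, ?_⟩
  set g : ℝ → ℝ := fun t => (eLpNorm (u t) p volume).toReal with hg
  have hA2 : eLpNorm g q (volume.restrict A) < ∞ := hA.2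
  have hB2 : eLpNorm g q (volume.restrict B) < ∞ := hB.2
  show eLpNorm g q (volume.restrict (A ∪ B)) < ∞
  rcases eq_or_ne q 0 with hq0 | hq0
  · simp [hq0]
  rcases eq_or_ne q ∞ with hqtop | hqtop
  · rw [hqtop, eLpNorm_exponent_top] at hA2 hB2 ⊢
    refine lt_of_le_of_lt (eLpNormEssSup_le_of_ae_enorm_bound ?_) (max_lt hA2 hB2)
    exact (ae_restrict_union_iff A B _).2
      ⟨(ae_le_eLpNormEssSup (μ := volume.restrict A) (f := g)).mono fun t ht =>
          ht.trans (le_max_left _ _),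
        (ae_le_eLpNormEssSup (μ := volume.restrict B) (f := g)).mono fun t ht =>
          ht.trans (le_max_right _ _)⟩
  · rw [eLpNorm_lt_top_iff_lintegral_rpow_enorm_lt_top hq0 hqtop] at hA2 hB2 ⊢
    refine lt_of_le_of_lt ?_ (ENNReal.add_lt_top.2 ⟨hA2, hB2⟩)
    refine (lintegral_mono' (Measure.restrict_union_le A B) le_rfl).trans ?_
    rw [lintegral_add_measure]

/-- On a set of times of finite measure, `L^∞_t` improves to `L^q_t`: if
`‖u t‖_{L^p} ≤ C` for a.e. `t ∈ S` (with `u t ∈ L^p`) and `volume S < ∞`, then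
`u ∈ L^q(S; L^p)` for every `q`. [folklore] -/
theorem memLqLp_of_ae_eLpNorm_le {q p : ℝ≥0∞} {u : ℝ → X → F} {S : Set ℝ} {C : ℝ≥0∞}
    (hC : C ≠ ∞) (hS : volume S ≠ ∞) (hmem : ∀ᵐ t ∂(volume.restrict S), MemLp (u t) p volume)
    (hle : ∀ᵐ t ∂(volume.restrict S), eLpNorm (u t) p volume ≤ C) : MemLqLp q p u S := by
  refine ⟨hmem, ?_⟩
  have hbound : ∀ᵐ t ∂(volume.restrict S), ‖(eLpNorm (u t) p volume).toReal‖ₑ ≤ C := by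
    filter_upwards [hle, hmem] with t ht ht'
    rwa [Real.enorm_eq_ofReal ENNReal.toReal_nonneg, ENNReal.ofReal_toReal ht'.eLpNorm_ne_top]
  refine lt_of_le_of_lt (eLpNorm_le_of_ae_enorm_bound hbound) ?_
  rw [Measure.restrict_apply_univ]
  refine ENNReal.mul_lt_top hC.lt_top (ENNReal.rpow_lt_top_of_nonneg (by positivity) hS)


/-! #### Interpolation of Lebesgue norms on a slice -/

/-- `∫⁻ ‖f‖ₑ^(m + n) ≤ ‖f‖_{L^∞}^m ∫⁻ ‖f‖ₑ^n` (pull out `m` factors by the essential supremum). [folklore] -/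
theorem lintegral_enorm_pow_add_le_essSup_pow_mul {α : Type*} {m0 : MeasurableSpace α}
    {μ : Measure α} {f : α → F} (hf : AEStronglyMeasurable f μ) (m n : ℕ) :
    ∫⁻ x, ‖f x‖ₑ ^ (m + n) ∂μ ≤ eLpNormEssSup f μ ^ m * ∫⁻ x, ‖f x‖ₑ ^ n ∂μ := by
  rw [← lintegral_const_mul'' _ (hf.enorm.pow_const n)]
  refine lintegral_mono_ae ?_
  filter_upwards [ae_le_eLpNormEssSup (μ := μ) (f := f)] with x hx
  rw [pow_add]
  gcongr

/-- **`L^∞ ∩ L³ ⊂ L⁵` on a slice**: `‖f‖₅⁵ ≤ ‖f‖_∞² ‖f‖₃³`. [folklore] -/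
theorem eLpNorm_five_pow_le {α : Type*} {m0 : MeasurableSpace α} {μ : Measure α} {f : α → F}
    (hf : AEStronglyMeasurable f μ) :
    eLpNorm f 5 μ ^ 5 ≤ eLpNorm f ∞ μ ^ 2 * eLpNorm f 3 μ ^ 3 := by
  have h5 := eLpNorm_natCast_pow_eq_lintegral μ f (n := 5) (by norm_num)
  have h3 := eLpNorm_natCast_pow_eq_lintegral μ f (n := 3) (by norm_num)
  simp only [Nat.cast_ofNat] at h5 h3
  rw [h5, h3, eLpNorm_exponent_top]
  exact lintegral_enorm_pow_add_le_essSup_pow_mul hf 2 3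

/-- **`L³ ∩ L⁶ ⊂ L⁴` on a slice**: `‖f‖₄⁴ ≤ ‖f‖₃² ‖f‖₆²` (Hölder with exponents `3/2`, `3` on
`|f|⁴ = |f|² · |f|²`). [folklore] -/
theorem eLpNorm_four_pow_le {α : Type*} {m0 : MeasurableSpace α} {μ : Measure α} {f : α → F}
    (hf : AEStronglyMeasurable f μ) :
    eLpNorm f 4 μ ^ 4 ≤ eLpNorm f 3 μ ^ 2 * eLpNorm f 6 μ ^ 2 := by
  have h4 := eLpNorm_natCast_pow_eq_lintegral μ f (n := 4) (by norm_num)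
  have h3 := eLpNorm_natCast_pow_eq_lintegral μ f (n := 3) (by norm_num)
  have h6 := eLpNorm_natCast_pow_eq_lintegral μ f (n := 6) (by norm_num)
  simp only [Nat.cast_ofNat] at h4 h3 h6
  -- `‖f‖₃² = (‖f‖₃³)^(2/3)` and `‖f‖₆² = (‖f‖₆⁶)^(1/3)`
  have e3 : eLpNorm f 3 μ ^ 2 = (eLpNorm f 3 μ ^ 3) ^ (2 / 3 : ℝ) := by
    rw [← ENNReal.rpow_natCast _ 3, ← ENNReal.rpow_mul, ← ENNReal.rpow_natCast _ 2]
    norm_num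
  have e6 : eLpNorm f 6 μ ^ 2 = (eLpNorm f 6 μ ^ 6) ^ (1 / 3 : ℝ) := by
    rw [← ENNReal.rpow_natCast _ 6, ← ENNReal.rpow_mul, ← ENNReal.rpow_natCast _ 2]
    norm_num
  rw [e3, e6, h4, h3, h6]
  have hmeas : AEMeasurable (fun x => ‖f x‖ₑ ^ 3) μ := hf.enorm.pow_const 3
  have hmeas' : AEMeasurable (fun x => ‖f x‖ₑ ^ 6) μ := hf.enorm.pow_const 6
  have key := ENNReal.lintegral_mul_norm_pow_le hmeas hmeas' (p := 2 / 3) (q := 1 / 3)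
    (by norm_num) (by norm_num) (by norm_num)
  refine le_trans (le_of_eq (lintegral_congr fun x => ?_)) key
  rw [← ENNReal.rpow_natCast _ 3, ← ENNReal.rpow_natCast _ 6, ← ENNReal.rpow_mul,
    ← ENNReal.rpow_mul, ← ENNReal.rpow_add_of_nonneg _ _ (by norm_num) (by norm_num),
    ← ENNReal.rpow_natCast _ 4]
  norm_num

/-! #### Interpolation of the mixed classes -/

/-- **`L^∞_t L^∞_x ∩ L^∞_t L³_x ⊂ L⁵_t L⁵_x` on a time set of finite measure** (the step
(3.6) ⇒ `v ∈ L₅(Q_{δ,T})` of Escauriaza–Seregin–Šverák 2003, §3, in the blunt form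
`∫∫ |v|⁵ ≤ C₁² ∫∫ |v|³ ≤ C₁² |S| ‖v‖_{3,∞}³`). [folklore] -/
theorem MemLqLp.five_of_top_top_of_top_three {u : ℝ → X → F} {S : Set ℝ}
    (htop : MemLqLp ∞ ∞ u S) (h₃ : MemLqLp ∞ 3 u S) (hS : volume S ≠ ∞) : MemLqLp 5 5 u S := by
  set M := eLqLpNorm ∞ ∞ u S with hM
  set N := eLqLpNorm ∞ 3 u S with hN
  have hMtop : M ≠ ∞ := htop.2.ne
  have hNtop : N ≠ ∞ := h₃.2.ne
  -- slice-wise bound `‖u t‖₅ ≤ (M² N³)^(1/5)`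
  have hslice : ∀ᵐ t ∂(volume.restrict S),
      MemLp (u t) 5 volume ∧ eLpNorm (u t) 5 volume ≤ (M ^ 2 * N ^ 3) ^ (5⁻¹ : ℝ) := by
    filter_upwards [htop.1, h₃.1, htop.ae_eLpNorm_le_top, h₃.ae_eLpNorm_le_top] with t h1 h2 h3 h4
    have hle : eLpNorm (u t) 5 volume ^ 5 ≤ M ^ 2 * N ^ 3 :=
      (eLpNorm_five_pow_le h2.1).trans (by gcongr)
    have hle' : eLpNorm (u t) 5 volume ≤ (M ^ 2 * N ^ 3) ^ (5⁻¹ : ℝ) := by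
      rw [ENNReal.le_rpow_inv_iff (by norm_num : (0 : ℝ) < 5)]
      exact_mod_cast (ENNReal.rpow_natCast _ 5).symm ▸ hle
    refine ⟨⟨h2.1, lt_of_le_of_lt hle' ?_⟩, hle'⟩
    exact ENNReal.rpow_lt_top_of_nonneg (by norm_num)
      (ENNReal.mul_ne_top (ENNReal.pow_ne_top hMtop) (ENNReal.pow_ne_top hNtop))
  exact memLqLp_of_ae_eLpNorm_le
    (ENNReal.rpow_ne_top_of_nonneg (by norm_num)
      (ENNReal.mul_ne_top (ENNReal.pow_ne_top hMtop) (ENNReal.pow_ne_top hNtop)))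
    hS (hslice.mono fun t ht => ht.1) (hslice.mono fun t ht => ht.2)

/-- **`L^∞_t L³_x ∩ L²_t L⁶_x ⊂ L⁴_t L⁴_x`** (`‖u(t)‖₄⁴ ≤ ‖u(t)‖₃² ‖u(t)‖₆²`, integrate in
time; the interpolation behind Escauriaza–Seregin–Šverák 2003, (1.11)–(1.12) and (3.2)). [folklore] -/
theorem MemLqLp.four_of_top_three_of_two_six {u : ℝ → X → F} {S : Set ℝ}
    (h₃ : MemLqLp ∞ 3 u S) (h₆ : MemLqLp 2 6 u S) : MemLqLp 4 4 u S := by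
  set N := eLqLpNorm ∞ 3 u S with hN
  have hNtop : N ≠ ∞ := h₃.2.ne
  -- slice-wise: `‖u t‖₄⁴ ≤ N² ‖u t‖₆²`, `u t ∈ L⁴`
  have hslice : ∀ᵐ t ∂(volume.restrict S), MemLp (u t) 4 volume ∧
      eLpNorm (u t) 4 volume ^ 4 ≤ N ^ 2 * eLpNorm (u t) 6 volume ^ 2 := by
    filter_upwards [h₃.1, h₆.1, h₃.ae_eLpNorm_le_top] with t h1 h2 h3
    have hle : eLpNorm (u t) 4 volume ^ 4 ≤ N ^ 2 * eLpNorm (u t) 6 volume ^ 2 :=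
      (eLpNorm_four_pow_le h1.1).trans (by gcongr)
    refine ⟨⟨h1.1, ?_⟩, hle⟩
    have hfin : eLpNorm (u t) 4 volume ^ 4 < ∞ :=
      lt_of_le_of_lt hle (ENNReal.mul_lt_top (ENNReal.pow_lt_top hNtop.lt_top)
        (ENNReal.pow_lt_top h2.eLpNorm_lt_top))
    exact (ENNReal.pow_lt_top_iff.1 hfin).resolve_right (by norm_num)
  refine ⟨hslice.mono fun t ht => ht.1, ?_⟩
  -- time integration
  have h6fin := h₆.2
  rw [eLqLpNorm] at h6fin ⊢
  rw [eLpNorm_lt_top_iff_lintegral_rpow_enorm_lt_top (by norm_num) (by norm_num)] at h6fin ⊢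
  simp only [ENNReal.toReal_ofNat] at h6fin ⊢
  have key : ∀ᵐ t ∂(volume.restrict S), ‖(eLpNorm (u t) 4 volume).toReal‖ₑ ^ (4 : ℝ) ≤
      N ^ 2 * ‖(eLpNorm (u t) 6 volume).toReal‖ₑ ^ (2 : ℝ) := by
    filter_upwards [hslice, h₆.1] with t ht h6
    rw [Real.enorm_eq_ofReal ENNReal.toReal_nonneg, Real.enorm_eq_ofReal ENNReal.toReal_nonneg,
      ENNReal.ofReal_toReal ht.1.eLpNorm_ne_top, ENNReal.ofReal_toReal h6.eLpNorm_ne_top,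
      show (4 : ℝ) = ((4 : ℕ) : ℝ) by norm_num, show (2 : ℝ) = ((2 : ℕ) : ℝ) by norm_num,
      ENNReal.rpow_natCast, ENNReal.rpow_natCast]
    exact ht.2
  refine lt_of_le_of_lt (lintegral_mono_ae key) ?_
  rw [lintegral_const_mul' _ _ (ENNReal.pow_ne_top hNtop)]
  exact ENNReal.mul_lt_top (ENNReal.pow_lt_top hNtop.lt_top) h6fin

end MixedAPI

/-! ### The initial datum of a Leray–Hopf solution -/

section Datum

variable {E : Type*} [NormedAddCommGroup E] [InnerProductSpace ℝ E] [FiniteDimensional ℝ E]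
  [MeasurableSpace E] [BorelSpace E]

omit [FiniteDimensional ℝ E] [MeasurableSpace E] [BorelSpace E] in
/-- `⟪f, g⟫` is integrable for `f, g ∈ L²` (Cauchy–Schwarz/Hölder). [folklore] -/
theorem integrable_inner_of_memLp_two {α : Type*} {m0 : MeasurableSpace α} {μ : Measure α}
    {f g : α → E} (hf : MemLp f 2 μ) (hg : MemLp g 2 μ) :
    Integrable (fun x => ⟪f x, g x⟫) μ := by
  have h : MemLp ((fun x => ‖g x‖) * fun x => ‖f x‖) 1 μ := hf.norm.mul hg.norm
  refine (memLp_one_iff_integrable.1 h).mono' (hf.1.inner hg.1) (Eventually.of_forall fun x => ?_)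
  rw [Pi.mul_apply, Real.norm_eq_abs, mul_comm]
  exact abs_real_inner_le_norm _ _

/-- A test in every non-empty right-neighbourhood of `0`: if a property holds for a.e.
`t ∈ (0, T)` then it holds at some `t ∈ (0, ε)` for every `0 < ε ≤ T`. [folklore] -/
theorem exists_mem_Ioo_of_ae_Ioo {T ε : ℝ} {P : ℝ → Prop} (hε : 0 < ε) (hεT : ε ≤ T)
    (h : ∀ᵐ t ∂(volume.restrict (Ioo 0 T)), P t) : ∃ t ∈ Ioo 0 ε, P t := by
  by_contra hne
  push Not at hne
  have h' : ∀ᵐ t ∂(volume.restrict (Ioo 0 ε)), P t :=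
    ae_mono (Measure.restrict_mono (Ioo_subset_Ioo_right hεT) le_rfl) h
  have hfalse : ∀ᵐ t ∂(volume.restrict (Ioo 0 ε)), False := by
    filter_upwards [h', ae_restrict_mem measurableSet_Ioo] with t ht ht'
    exact hne t ht' ht
  rw [eventually_false_iff_eq_bot, ae_eq_bot, Measure.restrict_eq_zero, Real.volume_Ioo,
    ENNReal.ofReal_eq_zero, sub_zero] at hfalse
  exact absurd hfalse (not_le.2 hε)

/-- A limit at `0⁺` of a function known a.e. on `(0, T)`: if `g → L` as `t → 0⁺` and `g t = c`
for a.e. `t ∈ (0, T)`, `T > 0`, then `L = c`. [folklore] -/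
theorem eq_of_tendsto_nhdsGT_of_ae_eq {β : Type*} [TopologicalSpace β] [T2Space β] {T : ℝ}
    (hT : 0 < T) {g : ℝ → β} {L c : β} (hg : Tendsto g (𝓝[>] 0) (𝓝 L))
    (hae : ∀ᵐ t ∂(volume.restrict (Ioo 0 T)), g t = c) : L = c := by
  refine tendsto_nhds_unique_of_frequently_eq hg tendsto_const_nhds ?_
  rw [Filter.frequently_iff]
  intro U hU
  obtain ⟨ε, hε, hεU⟩ := mem_nhdsGT_iff_exists_Ioo_subset.1 hU
  obtain ⟨t, ht, hPt⟩ := exists_mem_Ioo_of_ae_Ioo (lt_min hε hT) (min_le_right ε T) hae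
  exact ⟨t, hεU ⟨ht.1, ht.2.trans_le (min_le_left ε T)⟩, hPt⟩

variable {T ν : ℝ} {f u : ℝ → E → E} {u₀ : E → E}

/-- **The datum pairing is additive on `L²`.** For a Leray–Hopf solution on `[0, T)`, `T > 0`,
the (Bochner) pairings `w ↦ ∫ ⟪u₀, w⟫` are additive on `L²`: they are the limits as `t → 0⁺` of
the honest pairings `∫ ⟪u(t), w⟫` (weak continuity), which are additive since `u(t) ∈ L²`. This
holds whatever the function `u₀` is (the datum enters `IsLerayHopfOn` only through integrals). [folklore] -/
theorem IsLerayHopfOn.integral_inner_datum_add (h : IsLerayHopfOn T ν f u₀ u) (hT : 0 < T)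
    {w w' : E → E} (hw : MemLp w 2 volume) (hw' : MemLp w' 2 volume) :
    ∫ x, ⟪u₀ x, (w + w') x⟫ = (∫ x, ⟪u₀ x, w x⟫) + ∫ x, ⟪u₀ x, w' x⟫ := by
  have h1 := (h.weak_continuous w hw).2
  have h2 := (h.weak_continuous w' hw').2
  have h12 := (h.weak_continuous (w + w') (hw.add hw')).2
  refine tendsto_nhds_unique h12 ((h1.add h2).congr' ?_)
  have hev : ∀ᶠ t in 𝓝[>] (0 : ℝ), t ∈ Ioo 0 T := Ioo_mem_nhdsGT hT
  filter_upwards [hev] with t ht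
  have hut : MemLp (u t) 2 volume := h.memLp t (Ioo_subset_Icc_self ht)
  rw [← integral_add (integrable_inner_of_memLp_two hut hw)
    (integrable_inner_of_memLp_two hut hw')]
  refine integral_congr_ae (Eventually.of_forall fun x => ?_)
  simp only [Pi.add_apply, inner_add_right]

/-- **A non-integrable pairing kills the datum functional.** If for some `v ∈ L²` the pairing
`x ↦ ⟪u₀ x, v x⟫` is not integrable (which can only happen for a non-measurable `u₀`: the datum
of `IsLerayHopfOn` is an arbitrary function), then `∫ ⟪u₀, w⟫ = 0` for **every** `w ∈ L²`: by
additivity, `∫ ⟪u₀, w⟫ = ∫ ⟪u₀, w + v⟫ - ∫ ⟪u₀, v⟫`, and both pairings on the right are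
non-integrable, hence `0` (Bochner convention). [folklore] -/
theorem IsLerayHopfOn.integral_inner_datum_eq_zero (h : IsLerayHopfOn T ν f u₀ u) (hT : 0 < T)
    {v : E → E} (hv : MemLp v 2 volume) (hnv : ¬ Integrable (fun x => ⟪u₀ x, v x⟫) volume)
    {w : E → E} (hw : MemLp w 2 volume) : ∫ x, ⟪u₀ x, w x⟫ = 0 := by
  by_cases hiw : Integrable (fun x => ⟪u₀ x, w x⟫) volume
  · have hadd := h.integral_inner_datum_add hT hw hv
    have hnot : ¬ Integrable (fun x => ⟪u₀ x, (w + v) x⟫) volume := by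
      intro hi
      refine hnv ((hi.sub hiw).congr (Eventually.of_forall fun x => ?_))
      simp only [Pi.add_apply, inner_add_right, Pi.sub_apply, add_sub_cancel_left]
    rw [integral_undef hnot, integral_undef hnv, add_zero] at hadd
    exact hadd.symm
  · exact integral_undef hiw

/-- **Measurability test through `L²` pairings.** If every pairing `x ↦ ⟪u₀ x, w x⟫` with
`w ∈ L²` is integrable, then `u₀` is a.e. strongly measurable: test with `w = 𝟙_{B(0,n)} eᵢ` for
an orthonormal basis `(eᵢ)` and let `n → ∞`. [folklore] -/
theorem aestronglyMeasurable_of_forall_integrable_inner {u₀ : E → E}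
    (h : ∀ w : E → E, MemLp w 2 volume → Integrable (fun x => ⟪u₀ x, w x⟫) volume) :
    AEStronglyMeasurable u₀ volume := by
  set b := stdOrthonormalBasis ℝ E with hb
  -- each coordinate is a.e. strongly measurable
  have hcoord : ∀ i, AEStronglyMeasurable (fun x => ⟪u₀ x, b i⟫) volume := by
    intro i
    have hn : ∀ n : ℕ, AEStronglyMeasurable
        ((Metric.closedBall (0 : E) n).indicator fun x => ⟪u₀ x, b i⟫) volume := by
      intro n
      have hw : MemLp ((Metric.closedBall (0 : E) n).indicator fun _ => b i) 2 volume :=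
        memLp_indicator_const 2 measurableSet_closedBall (b i)
          (Or.inr (measure_closedBall_lt_top (x := (0 : E)) (r := (n : ℝ))).ne)
      have hint := h _ hw
      have heq : (fun x => ⟪u₀ x, (Metric.closedBall (0 : E) n).indicator (fun _ => b i) x⟫) =
          (Metric.closedBall (0 : E) n).indicator fun x => ⟪u₀ x, b i⟫ := by
        funext x
        by_cases hx : x ∈ Metric.closedBall (0 : E) n
        · simp [Set.indicator_of_mem hx]
        · simp [Set.indicator_of_notMem hx]
      rw [← heq]
      exact hint.aestronglyMeasurable
    refine aestronglyMeasurable_of_tendsto_ae atTop hn (ae_of_all _ fun x => ?_)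
    refine tendsto_const_nhds.congr' ?_
    filter_upwards [Filter.eventually_ge_atTop ⌈‖x‖⌉₊] with n hn'
    rw [Set.indicator_of_mem]
    rw [Metric.mem_closedBall, dist_zero_right]
    exact (Nat.le_ceil ‖x‖).trans (by exact_mod_cast hn')
  -- reassemble `u₀ = ∑ᵢ ⟪u₀, eᵢ⟫ eᵢ`
  have heq : u₀ = fun x => ∑ i, ⟪u₀ x, b i⟫ • b i := by
    funext x
    conv_lhs => rw [← b.sum_repr (u₀ x)]
    refine Finset.sum_congr rfl fun i _ => ?_
    rw [OrthonormalBasis.repr_apply_apply, real_inner_comm]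
  rw [heq]
  exact Finset.aestronglyMeasurable_fun_sum _ fun i _ => (hcoord i).smul_const (b i)

/-- **The dichotomy for the datum of a Leray–Hopf solution** (`T > 0`): either `u₀` is a.e.
strongly measurable, or the datum functional vanishes identically on `L²`,
`∫ ⟪u₀, w⟫ = 0` for all `w ∈ L²` (so that `u` is a weak solution with datum `0` and
`u(t) ⇀ 0` as `t → 0⁺`). [folklore] -/
theorem IsLerayHopfOn.aestronglyMeasurable_datum_or (h : IsLerayHopfOn T ν f u₀ u) (hT : 0 < T) :
    AEStronglyMeasurable u₀ volume ∨
      ∀ w : E → E, MemLp w 2 volume → ∫ x, ⟪u₀ x, w x⟫ = 0 := by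
  by_cases hall : ∀ w : E → E, MemLp w 2 volume → Integrable (fun x => ⟪u₀ x, w x⟫) volume
  · exact Or.inl (aestronglyMeasurable_of_forall_integrable_inner hall)
  · push Not at hall
    obtain ⟨v, hv, hnv⟩ := hall
    exact Or.inr fun w hw => h.integral_inner_datum_eq_zero hT hv hnv hw

/-- The time slices of a space–time test field lie in every `L^p` (continuous with compact
support, `IsSpaceTimeTestOn.hasCompactSupport_slice`). [folklore] -/
theorem IsSpaceTimeTestOn.memLp_slice {Q : Opens (ℝ × E)} {F' : Type*} [NormedAddCommGroup F']
    [NormedSpace ℝ F'] {ψ : ℝ → E → F'} (hψ : IsSpaceTimeTestOn Q ψ) (t : ℝ) (p : ℝ≥0∞) :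
    MemLp (ψ t) p volume :=
  (hψ.contDiff_slice t).continuous.memLp_of_hasCompactSupport (hψ.hasCompactSupport_slice t)

/-- **In the degenerate branch the solution has datum `0`.** If the datum functional of a
Leray–Hopf solution vanishes on `L²`, then `u` is a weak solution on `[0, T)` with datum `0`
(the datum enters the weak formulation only through `∫ ⟪u₀, ψ(0)⟫`, and `ψ(0) ∈ L²`). [folklore] -/
theorem IsLerayHopfOn.isWeakNSSolutionOn_zero_datum (h : IsLerayHopfOn T ν f u₀ u)
    (h0 : ∀ w : E → E, MemLp w 2 volume → ∫ x, ⟪u₀ x, w x⟫ = 0) :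
    IsWeakNSSolutionOn T ν f 0 u := by
  obtain ⟨hmeas, hL2, hdiv, hweak⟩ := h.weak
  refine ⟨hmeas, hL2, hdiv, fun ψ hψ hψdiv => ?_⟩
  have key := hweak ψ hψ hψdiv
  rw [h0 (ψ 0) (hψ.memLp_slice 0 2)] at key
  simpa using key

/-- **The datum is weakly divergence free** (whatever function it is): for a real test function
`θ`, `∫ ⟪u₀, ∇θ⟫ = lim_{t → 0⁺} ∫ ⟪u(t), ∇θ⟫` by weak continuity (`∇θ ∈ L²`), and the pairings
on the right vanish for a.e. `t ∈ (0, T)` (Escauriaza–Seregin–Šverák 2003, (3.1): "`a ∈ J̊`,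
this is the necessary condition following from (3.1)"). [folklore] -/
theorem IsLerayHopfOn.isWeaklyDivFree_datum (h : IsLerayHopfOn T ν f u₀ u) (hT : 0 < T) :
    IsWeaklyDivFree u₀ := by
  intro θ hθ
  have hgc : Continuous (gradient θ) :=
    (InnerProductSpace.toDual ℝ E).symm.continuous.comp (hθ.contDiff.continuous_fderiv (by simp))
  have hgs : HasCompactSupport (gradient θ) :=
    (hθ.hasCompactSupport.fderiv (𝕜 := ℝ)).comp_left (g := (InnerProductSpace.toDual ℝ E).symm)
      (map_zero _)
  have hw : MemLp (gradient θ) 2 volume := hgc.memLp_of_hasCompactSupport hgs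
  have hlim := (h.weak_continuous _ hw).2
  have hae : ∀ᵐ t ∂(volume.restrict (Ioo 0 T)), (∫ x, ⟪u t x, gradient θ x⟫) = 0 :=
    h.weak.ae_isWeaklyDivFree.mono fun t ht => ht θ hθ
  exact eq_of_tendsto_nhdsGT_of_ae_eq hT hlim hae

/-- **The datum is square integrable** when it is a.e. strongly measurable: `u(t) ∈ L²` for
`t ∈ [0, T]` and `‖u(t) - u₀‖₂ → 0` (Escauriaza–Seregin–Šverák 2003, (1.7)). [folklore] -/
theorem IsLerayHopfOn.memLp_two_datum (h : IsLerayHopfOn T ν f u₀ u) (hT : 0 < T)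
    (hu₀ : AEStronglyMeasurable u₀ volume) : MemLp u₀ 2 volume := by
  have hev : ∀ᶠ t in 𝓝[>] (0 : ℝ), eLpNorm (u t - u₀) 2 volume < 1 :=
    h.strong_initial (Iio_mem_nhds zero_lt_one)
  obtain ⟨t, ht, htT⟩ := (hev.and (Ioo_mem_nhdsGT hT)).exists
  have hut : MemLp (u t) 2 volume := h.memLp t (Ioo_subset_Icc_self htT)
  have hdiff : MemLp (u t - u₀) 2 volume := ⟨hut.1.sub hu₀, ht.trans ENNReal.one_lt_top⟩
  have := hut.sub hdiff
  simpa using this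

/-- **The datum inherits `L³`** (Escauriaza–Seregin–Šverák 2003, (3.1): "`‖v(·, t)‖₃` is
bounded for each `t ∈ [0, T]`", in particular `a ∈ L₃`): if `u ∈ L^∞(0, T; L³)` and the datum
`u₀` is a.e. strongly measurable, then `u₀ ∈ L³` — along a sequence `tₙ → 0⁺` of good times,
`u(tₙ) → u₀` in `L²`, a subsequence converges a.e., and Fatou's lemma bounds `‖u₀‖₃` by
`‖u‖_{L^∞ L³}`. [cite: EscauriazaSereginSverak2003, (3.1)] -/
theorem IsLerayHopfOn.memLp_three_datum (h : IsLerayHopfOn T ν f u₀ u) (hT : 0 < T)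
    (hu₀ : AEStronglyMeasurable u₀ volume) (h₃ : MemLqLp ∞ 3 u (Ioo 0 T)) :
    MemLp u₀ 3 volume := by
  set N := eLqLpNorm ∞ 3 u (Ioo 0 T) with hN
  have hNtop : N < ∞ := h₃.2
  -- good times accumulate at `0⁺`
  have hgood : ∀ᵐ t ∂(volume.restrict (Ioo 0 T)),
      MemLp (u t) 3 volume ∧ eLpNorm (u t) 3 volume ≤ N := by
    filter_upwards [h₃.1, h₃.ae_eLpNorm_le_top] with t h1 h2
    exact ⟨h1, h2⟩
  have hseq : ∀ n : ℕ, ∃ t ∈ Ioo (0 : ℝ) (min T (1 / ((n : ℝ) + 1))),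
      MemLp (u t) 3 volume ∧ eLpNorm (u t) 3 volume ≤ N := fun n =>
    exists_mem_Ioo_of_ae_Ioo (lt_min hT (by positivity)) (min_le_left _ _) hgood
  choose s hs hsg using hseq
  have hs0 : Tendsto s atTop (𝓝[>] 0) := by
    refine tendsto_nhdsWithin_iff.2 ⟨?_, Eventually.of_forall fun n => (hs n).1⟩
    refine squeeze_zero (fun n => (hs n).1.le) (fun n => ((hs n).2.trans_le (min_le_right _ _)).le)
      tendsto_one_div_add_atTop_nhds_zero_nat
  -- `u (s n) → u₀` in `L²`, hence in measure, hence a.e. along a subsequence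
  have hL2 : Tendsto (fun n => eLpNorm (u (s n) - u₀) 2 volume) atTop (𝓝 0) :=
    h.strong_initial.comp hs0
  have hmeas : ∀ n, AEStronglyMeasurable (u (s n)) volume := fun n => (hsg n).1.1
  obtain ⟨ns, -, hns⟩ := (tendstoInMeasure_of_tendsto_eLpNorm (by norm_num) hmeas hu₀
    hL2).exists_seq_tendsto_ae
  -- Fatou in `L³`
  have hFatou := Lp.eLpNorm_lim_le_liminf_eLpNorm (p := (3 : ℝ≥0∞)) (fun k => hmeas (ns k)) u₀ hns
  refine ⟨hu₀, lt_of_le_of_lt (hFatou.trans ?_) hNtop⟩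
  exact Filter.liminf_le_of_frequently_le' (Frequently.of_forall fun k => (hsg (ns k)).2)

end Datum

/-! ### Restriction in time of Leray–Hopf solutions -/

section LerayHopfMono

variable {E : Type*} [NormedAddCommGroup E] [InnerProductSpace ℝ E] [FiniteDimensional ℝ E]
  [MeasurableSpace E] [BorelSpace E]
variable {T T' ν : ℝ} {f u : ℝ → E → E} {u₀ : E → E}

/-- **Discharge of `Fluid.IsLerayHopfOn.mono`** (`LerayHopf`; Leray 1934, §III): a Leray–Hopf
weak solution on `[0, T)` is one on `[0, T')` for every `T' ≤ T`. The weak formulation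
restricts by `IsWeakNSSolutionOn.of_le` (`WeakSolutionProofs`); the energy bound, the a.e.
weak gradient and the a.e.-`s` energy inequality restrict along `Ioo 0 T' ⊆ Ioo 0 T`
(`ae_mono` for `Measure.restrict_mono`), the dissipation bound by monotonicity of the lower
integral in the time set, the slice conditions along `Icc 0 T' ⊆ Icc 0 T`,
`Icc s T' ⊆ Icc s T`, weak continuity along `Ioc 0 T' ⊆ Ioc 0 T`; the two conditions at
`t → 0⁺` do not see `T`. [cite: Leray1934, §III] -/
theorem IsLerayHopfOn.mono_holds :
    IsLerayHopfOn.mono (T := T) (T' := T') (ν := ν) (f := f) (u₀ := u₀) (u := u) := by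
  intro h hT
  have hIoo : Ioo (0 : ℝ) T' ⊆ Ioo 0 T := Ioo_subset_Ioo_right hT
  have hIcc : Icc (0 : ℝ) T' ⊆ Icc 0 T := Icc_subset_Icc_right hT
  have hμ : volume.restrict (Ioo (0 : ℝ) T') ≤ volume.restrict (Ioo 0 T) :=
    Measure.restrict_mono hIoo le_rfl
  obtain ⟨C, hC⟩ := h.energy_bound
  obtain ⟨G, hG, hGint, h0, hs⟩ := h.weakGrad_energy
  refine ⟨h.weak.of_le hT, ⟨C, ae_mono hμ hC⟩, fun t ht => h.memLp t (hIcc ht), ⟨G, ae_mono hμ hG,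
    lt_of_le_of_lt (lintegral_mono_set hIoo) hGint, fun t ht => h0 t (hIcc ht), ?_⟩,
    fun w hw => ⟨(h.weak_continuous w hw).1.mono (Ioc_subset_Ioc_right hT),
      (h.weak_continuous w hw).2⟩, h.strong_initial⟩
  exact Filter.Eventually.mono (ae_mono hμ hs) fun s hs' t ht => hs' t (Icc_subset_Icc_right hT ht)

/-- The restriction of a Leray–Hopf weak solution to a shorter time interval, as a usable lemma
(`IsLerayHopfOn.mono_holds`; Leray 1934, §III). [cite: Leray1934, §III] -/
theorem IsLerayHopfOn.of_le (h : IsLerayHopfOn T ν f u₀ u) (hT : T' ≤ T) :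
    IsLerayHopfOn T' ν f u₀ u :=
  IsLerayHopfOn.mono_holds h hT

/-- A global Leray–Hopf solution restricted to `[0, T)` and then to `[0, T')`, `0 < T' ≤ T`, is
the restriction to `[0, T')` (consistency of `IsGlobalLerayHopf.isLerayHopfOn` with `of_le`;
Leray 1934, §III). [cite: Leray1934, §III] -/
theorem IsGlobalLerayHopf.isLerayHopfOn_of_le (h : IsGlobalLerayHopf ν f u₀ u) (hT : 0 < T)
    (hT' : T' ≤ T) : IsLerayHopfOn T' ν f u₀ u :=
  (h.isLerayHopfOn hT).of_le hT'

end LerayHopfMono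

end Literature.Analysis.FluidPDE
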